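import Literature.Computability.AlgebraicComplexity.QuantumFunctionals
import Literature.Computability.AlgebraicComplexity.QuantumFunctionalsFree
import Literature.Computability.AlgebraicComplexity.MatMulPolystable
import Literature.Computability.AlgebraicComplexity.MatMulPolystableProofs
import Literature.Computability.AlgebraicComplexity.MatMulLieIsotropy
import Literature.Computability.AlgebraicComplexity.KumarLatinRectangles
import Literature.NumberTheory.DiophantineGeometry.SymmetricGroupReps
import HarnessLib

/-!
# Stabilizer periods, degree monoids and the fundamental invariant of tensors
# (Bürgisser–Ikenmeyer 2017, §4–§5)

P. Bürgisser, C. Ikenmeyer, *Fundamental invariants of orbit closures*, J. Algebra **477** (2017)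
390–434 = arXiv:1511.02927 [BurgisserIkenmeyer2017]. This file types §4 (*Stabilizer period and
polystability of tensors*) and §5 (*Fundamental invariant of tensors*) statement by statement, in
the numbering of the arXiv version (held text `paper:arxiv-1511.02927`, chunk locators
`pNNNN.txt:Lnn`; TeX line locators `main.tex Lnnn` of `pub-gct/inputs/files/src/1511.02927/main.tex`).
Sibling of `BI17FundamentalInvariantForms.lean` (§2–§3, forms). Typed literature for the cell
`val-lit` (row BI17-B); honest framing: nothing here is progress on VP versus VNP (or on `ω`).

Setting of the paper (§4, L1561–1570): cubic tensors `w ∈ W = ⊗³ℂ^m` with the action of `GL_m^3`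
via the tensor product. In the tree a tensor is `w : ι → ι → ι → k` (`m = |ι|`), the action of a
triple of matrices is `actTensor A B C w` (`(A ⊗ B ⊗ C)·w`, `QuantumFunctionals.lean`), the unit
tensor `⟨m⟩ = ∑_i e_i ⊗ e_i ⊗ e_i` (L1657) is `unitTensor k m` (`AsymptoticSpectrum.lean`), and the
matrix multiplication tensor in the coordinates of the paper, `⟨n,n,n⟩ = ∑_{ijk} |(ij)(jk)(ki)⟩`
(L2463, the trilinear form `tr(XYZ)`), is `biMatMulTensor k n` below — it is the tree's
`matMulTensor k n n n` (Bläser's coordinates) with the two components of the first index swapped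
(`biMatMulTensor_apply_eq`), i.e. a `GL³`-translate, so stabilizer period, polystability, degree and
exponent monoids agree. Polynomial functions on `⊗³k^ι` are `MvPolynomial (ι × ι × ι) k` evaluated
at `tensorPt w`.

## Coverage (source item → declaration → status)

§4.1 (L1571–1817, p0015–p0016):
* stabilizer `stab(w)` (4.1), L1580 → `tensorStab` (as a set of triples in `GL³`); `χ` (4.2), L1590
  → `tensorChi`; `H = χ(stab w)` → `tensorStabChiImage`; Def. 4.1 stabilizer period `a(w)` (L1600)
  → `tensorStabilizerPeriod` (`Nat.card`, `0` encoding `∞`); trivial (reduced) stabilizer (L1586) →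
  `HasTrivialTensorStabilizer`; "almost all tensors" (L1607) → `IsZariskiGenericTensor`.
* Thm. 4.2 (L1612, p0015:L51) → `BI2017_thm_4_2` FACT; Popov's theorem quoted in its proof
  (generic trivial stabilizer for `m > 3`, L1617) → `BI2017_popov_trivialStabilizer` FACT.
* Hessian identity (4.3)–(4.4) (L1649) — a proof tool, not typed.
* Thm. 4.3 (L1667, p0015:L109) → `BI2017_thm_4_3` FACT, PROVED as `BI2017_thm_4_3_holds` (slice identity
  `A diag(C_{k,·}) Bᵀ = E_{kk}` ⇒ monomial `A, B, C` with one common permutation; `χ = sgn π`, period `2`).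
  Prop. 4.4 (L1709) → `BI2017_prop_4_4` FACT (PROVED by t06 below, `BI2017_prop_4_4_holds`).
* Thm. 4.5 (de Groote; L1746, p0016:L31) → `BI2017_thm_4_5` FACT (for `biMatMulTensor`, the
  stabilizing triples being `(A ⊗ (B⁻¹)ᵀ, B ⊗ (C⁻¹)ᵀ, C ⊗ (A⁻¹)ᵀ)`, i.e. `X ↦ AXB⁻¹`, `Y ↦ BYC⁻¹`,
  `Z ↦ CZA⁻¹`). Cor. 4.6 (L1753) → `BI2017_cor_4_6` FACT. Prop. 4.7 (L1773) → `BI2017_prop_4_7` FACT.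
§4.2 (L1819–1941, p0016–p0017):
* polystable tensor (L1821) → `IsPolystableTensor` (closed `SL³`-orbit, Euclidean topology — the
  rendering of the tree's `BurgisserIkenmeyer2017_cor49_matMulTensor`, see
  `BurgisserIkenmeyer2017_cor49_matMulTensor_iff`); support (4.5) → CITE `tensorSupport`.
* Prop. 4.8 (L1841, p0016:L126) → `BI2017_prop_4_8_diag` FACT (diagonal `R`; `TODO(general form)`).
* Cor. 4.9 (L1892, p0017:L40): `⟨n,n,n⟩` → CITE `BurgisserIkenmeyer2017_cor49_matMulTensor`
  (`MatMulPolystable.lean`, PROVED in `MatMulPolystableProofs.lean`); the unit-tensor clause →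
  `BI2017_cor_4_9_unitTensor` FACT.
* Prop. 4.10 (L1923) → `BI2017_prop_4_10` FACT; "Any polystable tensor has a finite stabilizer
  period" (L1940) → `BI2017_polystableTensor_period` FACT.
§5 (L1944–2113, p0018):
* `φ_w(g w) = χ(g)^{a(w)}` (L1949): not introduced; Lemma 5.1(1)(2) (L1954; `O(Gw)` of the orbit) not
  typed; Lemma 5.1(3) / "`E(w) = m a(w) E'(w)`" (L1996) → `BI2017_lem_5_1_3` FACT.
* Def. 5.2 (L1978) → `tensorDegreeMonoid`, `tensorMinimalDegree`; Thm. 5.3 (L1990, p0018:L43) →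
  `BI2017_thm_5_3` FACT; exponent monoid `E'(w)`, `e'(w)` (L1996) → `tensorExponentMonoid`,
  `tensorMinimalExponent`; generic degree monoid `E(m)`, `e(m)` (5.1) (L2005) →
  `genericTensorDegreeMonoid`, `genericTensorMinimalDegree`; "`E(w) = E(m)` for almost all `w`"
  (L2012) → `BI2017_tensorDegreeMonoid_generic` FACT. The generic exponent monoid
  `E'(m) = E(m)/(m a(m))` is not introduced separately: by Thm. 4.2 `a(m) = 1` for `m > 2`, and the
  statements below are typed through `E(m)`, `e(m)`.
* `dim O(⊗³ℂ^m)^{SL³_m}_{mδ} = k_m(δ)` (L2021, "well-known", Landsberg–Manivel 2004) →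
  `BI2017_dim_sl3Invariants` FACT, `k_m(δ)` = `kronRect` (the tree's `kroneckerCoeff` of three
  `m × δ` rectangles); eq. (5.2) (L2029) → `BI2017_eq_5_2` FACT; Rem. 5.4 (`m = 2`, L2033) →
  `BI2017_rem_5_4` FACT; Examples 5.5/5.6 (L2041, L2069; DERKSEN/SCHUR computations) and Rem. 5.18
  (L2379) → `BI2017_ex_5_5`, `BI2017_ex_5_6` FACTS (computations in the source).
* Def. 5.7 fundamental invariant (L2089) → `IsTensorFundamentalInvariant`; Thm. 5.8 (L2097) →
  `BI2017_thm_5_8` FACT (parts 1 and 3; part 2, the coordinate ring of the orbit, not typed).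
§5.1 (L2116–2408, p0019–p0021):
* Thm. 5.9 (L2122, p0019:L3) → `BI2017_thm_5_9` FACT (with Alon–Tarsi statement `AT(m)` =
  `Kumar2015.latinColCount m ≠ 0`). Rem. 5.10 — alternative proof, not typed.
* Thm. 5.11 (L2216, p0019:L102) → `BI2017_thm_5_11` FACT. Cor. 5.12 (L2227) → `BI2017_cor_5_12` FACT.
* `F_n` (5.5) (L2258) → `sliceSign`, `labelSignX/Y/Z`, `fundInvariantTensor`; Thm. 5.13 (L2266,
  p0020:L33) → `BI2017_thm_5_13` FACT; "`F_n` is an irreducible polynomial" (L2345) →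
  `BI2017_fundInvariantTensor_irreducible` FACT; Rem. 5.14 (noncubic formats) not typed; Problems
  5.15–5.17, 5.19, 5.20 are open problems — not typed, except the verified range of Problem 5.19
  ("verified for `m ≤ 12`", L2393) → inside `BI2017_ex_5_6`.
§5.2 (L2411–2503, p0021–p0022):
* Def. 5.21 Latin cube (L2421) → `IsLatinCube`, `latinCubeSign`, `latinCubeCount`; Prop. 5.22
  (L2432) → `BI2017_prop_5_22` FACT; Problem 5.23 (3D Alon–Tarsi) is OPEN — not typed; its verified
  cases `n = 2, 4` (L2451) → `BI2017_latinCube_2_4` FACT (computation in the source).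
* Prop. 5.24 (L2470) → `BI2017_prop_5_24` FACT, PROVED as `BI2017_prop_5_24_holds` (labelings `[n]³ → [n²]`
  = pairs of coordinate maps; only chained triples survive at `⟨n,n,n⟩`). Cor. 5.25 (L2478) →
  `BI2017_cor_5_25` FACT.
  Cor. 5.26 (L2497; already in Bürgisser–Ikenmeyer 2011) → `BI2017_cor_5_26` FACT.
§6.4 (L2817–2862): Lemma 6.5 (GIT quotient) not typed (see the sibling file for §6).

## References

* [BurgisserIkenmeyer2017] P. Bürgisser, C. Ikenmeyer, *Fundamental invariants of orbit closures*,
  J. Algebra 477 (2017) 390–434; arXiv:1511.02927, §4–§5.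
* H. F. de Groote, *On varieties of optimal algorithms for the computation of bilinear mappings
  I*, Theoret. Comput. Sci. 7 (1978) (Thm. 4.5).
* P. Bürgisser, C. Ikenmeyer, *Geometric complexity theory and tensor rank*, STOC 2011 (Cor. 5.26).
-/

noncomputable section

open MvPolynomial

namespace Literature.Computability.AlgebraicComplexity

/-! ### §4.1 Stabilizer and stabilizer period of tensors -/

section TensorStabilizer

variable {ι k : Type*} [Fintype ι] [DecidableEq ι] [Field k]

/-- The **stabilizer** `stab(w) = {(g_1,g_2,g_3) ∈ GL_m^3 | (g_1 ⊗ g_2 ⊗ g_3) w = w}` of a tensor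
`w ∈ ⊗³k^ι` (BI 2017 eq. (4.1), L1580, p0015), as a set of triples (it is a subgroup; only the
underlying set is used below). [cite: BurgisserIkenmeyer2017, §4.1 eq. (4.1)] -/
def tensorStab (w : ι → ι → ι → k) : Set (GL ι k × GL ι k × GL ι k) :=
  {g | actTensor (g.1 : Matrix ι ι k) (g.2.1 : Matrix ι ι k) (g.2.2 : Matrix ι ι k) w = w}

/-- Membership in `tensorStab`, unfolded. [cite: BurgisserIkenmeyer2017, §4.1 eq. (4.1)] -/
theorem mem_tensorStab_iff (w : ι → ι → ι → k) (g : GL ι k × GL ι k × GL ι k) :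
    g ∈ tensorStab w ↔
      actTensor (g.1 : Matrix ι ι k) (g.2.1 : Matrix ι ι k) (g.2.2 : Matrix ι ι k) w = w :=
  Iff.rfl

/-- The character `χ : GL_m^3 → k^×, (g_1,g_2,g_3) ↦ det(g_1) det(g_2) det(g_3)` (BI 2017 eq. (4.2),
L1590). [cite: BurgisserIkenmeyer2017, §4.1 eq. (4.2)] -/
def tensorChi (g : GL ι k × GL ι k × GL ι k) : kˣ :=
  Matrix.GeneralLinearGroup.det g.1 * Matrix.GeneralLinearGroup.det g.2.1 *
    Matrix.GeneralLinearGroup.det g.2.2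

/-- The image `H = χ(stab(w)) ⊆ k^×` (BI 2017 §4.1, L1594: "a closed subgroup of `ℂ^×` … Either
`H = ℂ^×` or `H` equals the group `μ_a` of `a`-th roots of unity, where `a = |H|`").
[cite: BurgisserIkenmeyer2017, §4.1] -/
def tensorStabChiImage (w : ι → ι → ι → k) : Set kˣ :=
  tensorChi '' tensorStab w

/-- **BI 2017, Def. 4.1** (L1600, p0015:L41): "The stabilizer period `a(w)` of a tensor
`w ∈ ⊗³ℂ^m` is defined as the order of `χ(stab(w))`." Rendered as `Nat.card` of `χ(stab(w))`, the
value `0` encoding an infinite `H` (`a(w) = ∞`). [cite: BurgisserIkenmeyer2017, Def. 4.1] -/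
def tensorStabilizerPeriod (w : ι → ι → ι → k) : ℕ :=
  Nat.card (tensorStabChiImage w)

/-- "`w` has a trivial stabilizer": the reduced stabilizer `stab'(w) = stab(w)/K` is trivial, where
`K = {(ζ_1 I, ζ_2 I, ζ_3 I) | ζ_1 ζ_2 ζ_3 = 1}` acts trivially (BI 2017 §4.1, L1574–1587).
[cite: BurgisserIkenmeyer2017, §4.1] -/
def HasTrivialTensorStabilizer (w : ι → ι → ι → k) : Prop :=
  ∀ g ∈ tensorStab w, ∃ ζ₁ ζ₂ ζ₃ : k, ζ₁ * ζ₂ * ζ₃ = 1 ∧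
    (g.1 : Matrix ι ι k) = ζ₁ • (1 : Matrix ι ι k) ∧ (g.2.1 : Matrix ι ι k) = ζ₂ • (1 : Matrix ι ι k) ∧
      (g.2.2 : Matrix ι ι k) = ζ₃ • (1 : Matrix ι ι k)

/-- The point of the affine space `⊗³k^ι = (ι × ι × ι → k)` given by a tensor (coordinates
`w_{abc}`, BI 2017 §5.1, L2254 "We express a tensor `w = ∑ w_{abc} |abc⟩` in the standard basis").
[cite: BurgisserIkenmeyer2017, §5.1] -/
def tensorPt (w : ι → ι → ι → k) : ι × ι × ι → k :=
  fun p => w p.1 p.2.1 p.2.2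

/-- "Almost all `w ∈ ⊗³ℂ^m` satisfy `P`" (BI 2017 §4.1, L1607 "almost all `w ∈ ⊗³ℂ^m` have the
stabilizer period `a(m)`"; Prop. 4.10): off the zero set of a nonzero polynomial in the `m³`
coordinates. [cite: BurgisserIkenmeyer2017, §4.1] -/
def IsZariskiGenericTensor (P : (ι → ι → ι → k) → Prop) : Prop :=
  ∃ F : MvPolynomial (ι × ι × ι) k, F ≠ 0 ∧ ∀ w : ι → ι → ι → k, aeval (tensorPt w) F ≠ 0 → P w

/-- BI's matrix multiplication tensor `⟨n,n,n⟩ = ∑_{i,j,k} |(ij)(jk)(ki)⟩ ∈ ⊗³k^{n×n}`, the trilinear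
form `tr(XYZ)` (BI 2017 §4.1, L1741; §5.2, L2463). [cite: BurgisserIkenmeyer2017, §4.1 (before Thm. 4.5)] -/
def biMatMulTensor (k : Type*) [Field k] (n : ℕ) :
    Fin n × Fin n → Fin n × Fin n → Fin n × Fin n → k :=
  fun a b c => if a.2 = b.1 ∧ b.2 = c.1 ∧ c.2 = a.1 then 1 else 0

/-- `⟨n,n,n⟩` in BI's coordinates is the tree's `matMulTensor k n n n` (Bläser's coordinates
`∑ e_{(i,l)} ⊗ e_{(i,j)} ⊗ e_{(j,l)}`) with the first index transposed: a `GL³`-translate by a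
permutation matrix in the first factor. [cite: BurgisserIkenmeyer2017, §4.1 (before Thm. 4.5)] -/
theorem biMatMulTensor_apply_eq (n : ℕ) (a b c : Fin n × Fin n) :
    biMatMulTensor k n a b c = matMulTensor k n n n a.swap b c := by
  have h : (c.2 = a.1) = (a.1 = c.2) := propext eq_comm
  simp only [biMatMulTensor, matMulTensor, Prod.fst_swap, Prod.snd_swap, h]
  exact if_congr Iff.rfl rfl rfl

end TensorStabilizer

/-! ### §4.1 Theorems 4.2–4.7 (named facts) -/

section TensorStabilizerFacts

/-- **BI 2017, Thm. 4.2** (L1612, p0015:L51): "We have `a(m) = 1` for `m ≥ 3` and `a(2) = 2`"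
(`a(m)` = the stabilizer period of almost all `w ∈ ⊗³ℂ^m`, L1607). [cite: BurgisserIkenmeyer2017, Thm. 4.2] -/
def BI2017_thm_4_2 : Prop :=
  (∀ m : ℕ, 3 ≤ m →
    IsZariskiGenericTensor fun w : Fin m → Fin m → Fin m → ℂ => tensorStabilizerPeriod w = 1) ∧
  IsZariskiGenericTensor fun w : Fin 2 → Fin 2 → Fin 2 → ℂ => tensorStabilizerPeriod w = 2

/-- **A. M. Popov 1987, Thm. 2, as quoted in BI 2017** (proof of Thm. 4.2, L1616–1618): "if `m > 3`,
then almost all `w ∈ ⊗³ℂ^m` have a trivial stabilizer group, hence `a(m) = 1`."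
[cite: BurgisserIkenmeyer2017, Thm. 4.2 (proof)] -/
def BI2017_popov_trivialStabilizer : Prop :=
  ∀ m : ℕ, 3 < m →
    IsZariskiGenericTensor (HasTrivialTensorStabilizer : (Fin m → Fin m → Fin m → ℂ) → Prop)

/-- **BI 2017, Thm. 4.3** (L1667, p0015:L109; de Groote 1978, Bürgisser–Ikenmeyer 2011): "The
stabilizer `H_m` of the unit tensor `⟨m⟩` in `GL_m^3` is the semidirect product of the subgroup
`T_m := {(diag(a),diag(b),diag(c)) | ∀ i a_i b_i c_i = 1}`, and the symmetric group `S_m` diagonally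
embedded in `G_m` via `π ↦ (P_π,P_π,P_π)`. … The stabilizer period of `⟨m⟩` equals `2` if `m > 1`."
Typed as the set equality `stab(⟨m⟩) = {(diag(a)P_π, diag(b)P_π, diag(c)P_π) | ∀ i, a_i b_i c_i = 1}`
and the period. [cite: BurgisserIkenmeyer2017, Thm. 4.3] -/
def BI2017_thm_4_3 : Prop :=
  ∀ m : ℕ,
    tensorStab (unitTensor ℂ m) =
      {g | ∃ (π : Equiv.Perm (Fin m)) (a b c : Fin m → ℂ), (∀ i, a i * b i * c i = 1) ∧
        (g.1 : Matrix (Fin m) (Fin m) ℂ) = Matrix.diagonal a * π.permMatrix ℂ ∧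
        (g.2.1 : Matrix (Fin m) (Fin m) ℂ) = Matrix.diagonal b * π.permMatrix ℂ ∧
        (g.2.2 : Matrix (Fin m) (Fin m) ℂ) = Matrix.diagonal c * π.permMatrix ℂ} ∧
    (1 < m → tensorStabilizerPeriod (unitTensor ℂ m) = 2)

/-- **BI 2017, Prop. 4.4** (L1709, p0015:L153): "If the stabilizer of some tensor
`w ∈ ℂ^m ⊗ ℂ^m ⊗ ℂ^m` contains the stabilizer `H_m` of the unit tensor `⟨m⟩`, then `w = c ⟨m⟩` for
some `c ∈ ℂ`." [cite: BurgisserIkenmeyer2017, Prop. 4.4] -/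
def BI2017_prop_4_4 : Prop :=
  ∀ (m : ℕ) (w : Fin m → Fin m → Fin m → ℂ),
    tensorStab (unitTensor ℂ m) ⊆ tensorStab w → ∃ c : ℂ, w = c • unitTensor ℂ m

/-- **BI 2017, Thm. 4.5 (de Groote 1978; Skolem–Noether)** (L1746, p0016:L31): "The stabilizer of
`tr(XYZ)` in `GL_{n²}^3` is given by the transformations `X ↦ AXB⁻¹, Y ↦ BYC⁻¹, Z ↦ CZA⁻¹`, where
`A,B,C ∈ GL_n`." On the tensor `⟨n,n,n⟩ = ∑ |(ij)(jk)(ki)⟩` these transformations act by the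
Kronecker matrices `A ⊗ (B⁻¹)ᵀ`, `B ⊗ (C⁻¹)ᵀ`, `C ⊗ (A⁻¹)ᵀ` on `k^{n×n}` (`(A ⊗ (B⁻¹)ᵀ)e_{ij} =
A e_{ij} B⁻¹`). [cite: BurgisserIkenmeyer2017, Thm. 4.5] -/
def BI2017_thm_4_5 : Prop :=
  ∀ n : ℕ,
    tensorStab (biMatMulTensor ℂ n) =
      {g | ∃ A B C : GL (Fin n) ℂ,
        (g.1 : Matrix (Fin n × Fin n) (Fin n × Fin n) ℂ) =
          Matrix.kronecker (A : Matrix (Fin n) (Fin n) ℂ)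
            ((B⁻¹ : GL (Fin n) ℂ) : Matrix (Fin n) (Fin n) ℂ).transpose ∧
        (g.2.1 : Matrix (Fin n × Fin n) (Fin n × Fin n) ℂ) =
          Matrix.kronecker (B : Matrix (Fin n) (Fin n) ℂ)
            ((C⁻¹ : GL (Fin n) ℂ) : Matrix (Fin n) (Fin n) ℂ).transpose ∧
        (g.2.2 : Matrix (Fin n × Fin n) (Fin n × Fin n) ℂ) =
          Matrix.kronecker (C : Matrix (Fin n) (Fin n) ℂ)
            ((A⁻¹ : GL (Fin n) ℂ) : Matrix (Fin n) (Fin n) ℂ).transpose}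

/-- **BI 2017, Cor. 4.6** (L1753, p0016:L37): "The tensor `⟨n,n,n⟩` of matrix multiplication has the
stabilizer period `1`." (`χ(g) = det(A)^n det(B)^{-n} det(B)^n det(C)^{-n} det(C)^n det(A)^{-n} = 1`.)
[cite: BurgisserIkenmeyer2017, Cor. 4.6] -/
def BI2017_cor_4_6 : Prop :=
  ∀ n : ℕ, tensorStabilizerPeriod (biMatMulTensor ℂ n) = 1

/-- **BI 2017, Prop. 4.7** (L1773, p0016:L58): "If the stabilizer of some tensor `w ∈ ⊗³ℂ^{n×n}`
contains the stabilizer of `⟨n,n,n⟩`, then `w = c ⟨n,n,n⟩` for some `c ∈ ℂ`." [cite: BurgisserIkenmeyer2017, Prop. 4.7] -/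
def BI2017_prop_4_7 : Prop :=
  ∀ (n : ℕ) (w : Fin n × Fin n → Fin n × Fin n → Fin n × Fin n → ℂ),
    tensorStab (biMatMulTensor ℂ n) ⊆ tensorStab w → ∃ c : ℂ, w = c • biMatMulTensor ℂ n

end TensorStabilizerFacts

/-! ### §4.2 Polystability of tensors -/

section TensorPolystability

variable {ι : Type*} [Fintype ι] [DecidableEq ι]

/-- **Polystable tensor** (BI 2017 §4.2, L1821: "We call a tensor `w ∈ ⊗³ℂ^m` polystable iff the
`SL_m^3`-orbit of `w` is closed"). Rendered, exactly as in the tree's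
`BurgisserIkenmeyer2017_cor49_matMulTensor` (`MatMulPolystable.lean`), as closedness of the range
of the `SL³`-action map in the Euclidean topology of `(ι → ι → ι → ℂ)` (equal to the Zariski
closure for orbits of connected complex algebraic groups). [cite: BurgisserIkenmeyer2017, §4.2] -/
def IsPolystableTensor (w : ι → ι → ι → ℂ) : Prop :=
  IsClosed (Set.range fun g : Matrix.SpecialLinearGroup ι ℂ × Matrix.SpecialLinearGroup ι ℂ ×
      Matrix.SpecialLinearGroup ι ℂ =>
    actTensor (g.1 : Matrix ι ι ℂ) (g.2.1 : Matrix ι ι ℂ) (g.2.2 : Matrix ι ι ℂ) w)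

/-- The tree's fact `BurgisserIkenmeyer2017_cor49_matMulTensor` (BI Cor. 4.9 for `⟨n,n,n⟩`) is
literally polystability, in the sense of `IsPolystableTensor`, of `matMulTensor ℂ n n n` for all `n`.
[cite: BurgisserIkenmeyer2017, Cor. 4.9] -/
theorem BurgisserIkenmeyer2017_cor49_matMulTensor_iff :
    BurgisserIkenmeyer2017_cor49_matMulTensor ↔ ∀ n : ℕ, IsPolystableTensor (matMulTensor ℂ n n n) :=
  Iff.rfl

/-- **BI 2017, Prop. 4.8** (L1841, p0016:L126; Hilbert–Mumford/Luna/Kempf), in the special case of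
a DIAGONAL subgroup `R`: "Let the tensor `w ∈ ⊗³ℂ^m` satisfy the following two properties: 1. There
is a reductive subgroup `R` of `SL_m^3 ∩ stab(w)` such that the centralizer of `R` in `SL_m^3` is
contained in `T_m^3`. 2. There is a probability distribution `α` on `supp(w)` such that its marginals
`α^1, α^2, α^3` are the uniform distributions on `[m]`. Then `w` is polystable." Here `R ≤ SL_m^3`
consists of triples of diagonal matrices stabilizing `w` (the case of both applications in Cor.
4.9); `α` has rational values, `supp(w)` = `tensorSupport w` (eq. (4.5), L1826).
-- TODO(general form): `R` an arbitrary reductive algebraic subgroup of `SL_m^3 ∩ stab(w)`.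
[cite: BurgisserIkenmeyer2017, Prop. 4.8] -/
def BI2017_prop_4_8_diag : Prop :=
  ∀ (m : ℕ) (w : Fin m → Fin m → Fin m → ℂ)
    (R : Subgroup (Matrix.SpecialLinearGroup (Fin m) ℂ × Matrix.SpecialLinearGroup (Fin m) ℂ ×
      Matrix.SpecialLinearGroup (Fin m) ℂ)),
    (∀ r ∈ R, (r.1 : Matrix (Fin m) (Fin m) ℂ).IsDiag ∧ (r.2.1 : Matrix (Fin m) (Fin m) ℂ).IsDiag ∧
      (r.2.2 : Matrix (Fin m) (Fin m) ℂ).IsDiag ∧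
      actTensor (r.1 : Matrix (Fin m) (Fin m) ℂ) (r.2.1 : Matrix (Fin m) (Fin m) ℂ)
        (r.2.2 : Matrix (Fin m) (Fin m) ℂ) w = w) →
    (∀ g : Matrix.SpecialLinearGroup (Fin m) ℂ × Matrix.SpecialLinearGroup (Fin m) ℂ ×
        Matrix.SpecialLinearGroup (Fin m) ℂ,
      (∀ r ∈ R, g * r = r * g) →
        (g.1 : Matrix (Fin m) (Fin m) ℂ).IsDiag ∧ (g.2.1 : Matrix (Fin m) (Fin m) ℂ).IsDiag ∧
          (g.2.2 : Matrix (Fin m) (Fin m) ℂ).IsDiag) →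
    (∃ α : Fin m × Fin m × Fin m → ℚ, (∀ p, 0 ≤ α p) ∧ (∀ p, p ∉ tensorSupport w → α p = 0) ∧
      (∀ i : Fin m, ∑ j, ∑ l, α (i, j, l) = 1 / m) ∧ (∀ j : Fin m, ∑ i, ∑ l, α (i, j, l) = 1 / m) ∧
      (∀ l : Fin m, ∑ i, ∑ j, α (i, j, l) = 1 / m)) →
    IsPolystableTensor w

/-- **BI 2017, Cor. 4.9, the unit-tensor clause** (L1892, p0017:L40; shown by Meyer 2006): "The unit
tensors `⟨m⟩` and the matrix multiplication tensors `⟨n,n,n⟩` are polystable." The `⟨n,n,n⟩` clause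
is the tree's `BurgisserIkenmeyer2017_cor49_matMulTensor` (`MatMulPolystable.lean`, PROVED in
`MatMulPolystableProofs.lean`) and is not restated. [cite: BurgisserIkenmeyer2017, Cor. 4.9] -/
def BI2017_cor_4_9_unitTensor : Prop :=
  ∀ m : ℕ, IsPolystableTensor (unitTensor ℂ m)

/-- **BI 2017, Prop. 4.10** (L1923, p0017:L69; Thm. 4.2 + Luna 1973): "Almost all `w ∈ ⊗³ℂ^m` are
polystable." [cite: BurgisserIkenmeyer2017, Prop. 4.10] -/
def BI2017_prop_4_10 : Prop :=
  ∀ m : ℕ, IsZariskiGenericTensor (IsPolystableTensor : (Fin m → Fin m → Fin m → ℂ) → Prop)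

/-- **BI 2017, §4.2, last sentence** (L1940): "Any polystable tensor has a finite stabilizer period
(the proof is as for Proposition 2.11)." (`w ≠ 0`; finiteness = `tensorStabilizerPeriod w ≠ 0`.)
[cite: BurgisserIkenmeyer2017, §4.2 (after Prop. 4.10)] -/
def BI2017_polystableTensor_period : Prop :=
  ∀ (m : ℕ) (w : Fin m → Fin m → Fin m → ℂ), w ≠ 0 → IsPolystableTensor w →
    tensorStabilizerPeriod w ≠ 0

end TensorPolystability

/-! ### §5 Polynomial functions on `⊗³`, `SL³`-invariants, degree and exponent monoids -/

section TensorInvariants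

variable {ι k : Type*} [Fintype ι] [DecidableEq ι] [Field k]

/-- A polynomial function `F` on `⊗³k^ι` is `SL³`-invariant: `F((g_1 ⊗ g_2 ⊗ g_3)w) = F(w)` for all
`g_i ∈ SL(ι)` and all tensors `w` (the invariant ring `O(⊗³ℂ^m)^{SL^3_m}` of BI 2017 §5, L1981,
L2005). [cite: BurgisserIkenmeyer2017, §5] -/
def IsSL3Invariant (F : MvPolynomial (ι × ι × ι) k) : Prop :=
  ∀ (g₁ g₂ g₃ : Matrix.SpecialLinearGroup ι k) (w : ι → ι → ι → k),
    aeval (tensorPt (actTensor (g₁ : Matrix ι ι k) (g₂ : Matrix ι ι k) (g₃ : Matrix ι ι k) w)) F =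
      aeval (tensorPt w) F

/-- The `SL³`-invariant polynomial functions form a submodule. [cite: BurgisserIkenmeyer2017, §5] -/
def sl3InvariantSubmodule (ι k : Type*) [Fintype ι] [DecidableEq ι] [Field k] :
    Submodule k (MvPolynomial (ι × ι × ι) k) where
  carrier := {F | IsSL3Invariant F}
  add_mem' {F G} hF hG := fun g₁ g₂ g₃ w => by rw [map_add, map_add, hF, hG]
  zero_mem' := fun g₁ g₂ g₃ w => by rw [map_zero, map_zero]
  smul_mem' c {F} hF := fun g₁ g₂ g₃ w => by rw [map_smul, map_smul, hF]

/-- The degree-`d` part `O(⊗³k^ι)^{SL³}_d` of the invariant ring (BI 2017 eq. (5.1), L2005).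
[cite: BurgisserIkenmeyer2017, §5 eq. (5.1)] -/
def sl3InvariantsOfDegree (ι k : Type*) [Fintype ι] [DecidableEq ι] [Field k] (d : ℕ) :
    Submodule k (MvPolynomial (ι × ι × ι) k) :=
  homogeneousSubmodule (ι × ι × ι) k d ⊓ sl3InvariantSubmodule ι k

/-- Membership in `O(⊗³)^{SL³}_d`. [cite: BurgisserIkenmeyer2017, §5 eq. (5.1)] -/
theorem mem_sl3InvariantsOfDegree_iff (d : ℕ) (F : MvPolynomial (ι × ι × ι) k) :
    F ∈ sl3InvariantsOfDegree ι k d ↔ F.IsHomogeneous d ∧ IsSL3Invariant F := by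
  rw [sl3InvariantsOfDegree, Submodule.mem_inf, mem_homogeneousSubmodule]
  rfl

/-- The `GL³`-orbit `Gw = {(g_1 ⊗ g_2 ⊗ g_3) w}` of a tensor (BI 2017 §5, L1949).
[cite: BurgisserIkenmeyer2017, §5] -/
def tensorGLOrbit (w : ι → ι → ι → k) : Set (ι → ι → ι → k) :=
  {v | ∃ g : GL ι k × GL ι k × GL ι k,
    v = actTensor (g.1 : Matrix ι ι k) (g.2.1 : Matrix ι ι k) (g.2.2 : Matrix ι ι k) w}

/-- The vanishing ideal `I(Gw)` of the orbit in `k[⊗³] = MvPolynomial (ι × ι × ι) k`; the coordinate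
ring of the orbit closure `\overline{Gw}` is the quotient by it (BI 2017 §5, `O(\overline{Gw})`,
L1981). [cite: BurgisserIkenmeyer2017, §5] -/
def tensorOrbitVanishingIdeal (w : ι → ι → ι → k) : Ideal (MvPolynomial (ι × ι × ι) k) :=
  MvPolynomial.vanishingIdeal k (tensorPt '' tensorGLOrbit w)

/-- The coordinate ring `O(\overline{Gw}) = k[⊗³] ⧸ I(Gw)` of the orbit closure of a tensor
(BI 2017 §5). [cite: BurgisserIkenmeyer2017, §5] -/
abbrev TensorOrbitCoordRing (w : ι → ι → ι → k) : Type _ :=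
  MvPolynomial (ι × ι × ι) k ⧸ tensorOrbitVanishingIdeal w

/-- The **degree monoid** of a tensor, `E(w) := {d ∈ ℕ | O(\overline{Gw})^{SL^3_m}_d ≠ 0}` (BI 2017
Def. 5.2, L1978, p0018:L30): degrees carrying a homogeneous `SL³`-invariant polynomial function not
vanishing identically on `Gw` (see the sibling file's module docstring for this rendering of
`O(\overline{Gw})^{SL}_d ≠ 0`). [cite: BurgisserIkenmeyer2017, Def. 5.2] -/
def tensorDegreeMonoid (w : ι → ι → ι → k) : Set ℕ :=
  {d | ∃ F : MvPolynomial (ι × ι × ι) k,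
    F.IsHomogeneous d ∧ IsSL3Invariant F ∧ F ∉ tensorOrbitVanishingIdeal w}

/-- The **minimal degree** `e(w)` of a tensor: the minimal positive element of `E(w)` (BI 2017
Def. 5.2, L1983; junk `0` if none). [cite: BurgisserIkenmeyer2017, Def. 5.2] -/
def tensorMinimalDegree (w : ι → ι → ι → k) : ℕ :=
  sInf {d | d ∈ tensorDegreeMonoid w ∧ 0 < d}

/-- The **exponent monoid** `E'(w) := {k | (φ_w)^k has a regular extension to \overline{Gw}}` of a
tensor, `φ_w(g w) = χ(g)^{a(w)}` (BI 2017 §5, L1949, L1996): `e ∈ E'(w)` iff some polynomial function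
`F` satisfies `F(g·w) = χ(g)^{a(w) e}` for all `g ∈ GL³`. [cite: BurgisserIkenmeyer2017, §5 (after Thm. 5.3)] -/
def tensorExponentMonoid (w : ι → ι → ι → k) : Set ℕ :=
  {e | ∃ F : MvPolynomial (ι × ι × ι) k, ∀ g : GL ι k × GL ι k × GL ι k,
    aeval (tensorPt (actTensor (g.1 : Matrix ι ι k) (g.2.1 : Matrix ι ι k) (g.2.2 : Matrix ι ι k) w))
      F = ((tensorChi g : kˣ) : k) ^ (tensorStabilizerPeriod w * e)}

/-- The **minimal exponent** `e'(w)`: the minimal positive element of `E'(w)` (BI 2017 §5, L1999;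
junk `0` if none). [cite: BurgisserIkenmeyer2017, §5 (after Thm. 5.3)] -/
def tensorMinimalExponent (w : ι → ι → ι → k) : ℕ :=
  sInf {e | e ∈ tensorExponentMonoid w ∧ 0 < e}

/-- The **generic degree monoid of tensors** `E(m) := {d ∈ ℕ | O(⊗³ℂ^m)^{SL^3_m}_d ≠ 0}` (BI 2017
eq. (5.1), L2005). [cite: BurgisserIkenmeyer2017, §5 eq. (5.1)] -/
def genericTensorDegreeMonoid (ι k : Type*) [Fintype ι] [DecidableEq ι] [Field k] : Set ℕ :=
  {d | ∃ F : MvPolynomial (ι × ι × ι) k, F.IsHomogeneous d ∧ IsSL3Invariant F ∧ F ≠ 0}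

/-- The **generic minimal degree** `e(m)`: the minimal positive element of `E(m)` (BI 2017 §5,
L2008; junk `0` if none). [cite: BurgisserIkenmeyer2017, §5 eq. (5.1)] -/
def genericTensorMinimalDegree (ι k : Type*) [Fintype ι] [DecidableEq ι] [Field k] : ℕ :=
  sInf {d | d ∈ genericTensorDegreeMonoid ι k ∧ 0 < d}

/-- A polynomial function `Φ` on `⊗³` **represents the fundamental invariant** `Φ_w` of the tensor
`w`: "the `SL^3_m`-invariant `Φ_w` in `O(\overline{Gw})` of the (minimal) degree `e(w)` satisfying
`Φ_w(w) = 1`" (BI 2017 Def. 5.7, L2089, p0018:L143). [cite: BurgisserIkenmeyer2017, Def. 5.7] -/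
def IsTensorFundamentalInvariant (w : ι → ι → ι → k) (Φ : MvPolynomial (ι × ι × ι) k) : Prop :=
  Φ.IsHomogeneous (tensorMinimalDegree w) ∧ IsSL3Invariant Φ ∧ aeval (tensorPt w) Φ = 1

/-- The vanishing ideal in `k[⊗³]` of the boundary `\overline{Gw} ∖ Gw` of the orbit of a complex
tensor (closure in the Euclidean topology of `(ι → ι → ι → ℂ)`, equal to the Zariski closure for an
orbit; BI 2017 Thm. 5.8, L2105). [cite: BurgisserIkenmeyer2017, Thm. 5.8] -/
def tensorBoundaryVanishingIdeal (w : ι → ι → ι → ℂ) : Ideal (MvPolynomial (ι × ι × ι) ℂ) :=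
  MvPolynomial.vanishingIdeal ℂ (tensorPt '' (closure (tensorGLOrbit w) \ tensorGLOrbit w))

open Literature.NumberTheory.DiophantineGeometry in
/-- `k_m(δ) := k(m × δ, m × δ, m × δ)`, "the Kronecker coefficient assigned to three partitions of the
same rectangular shape `m × δ := (δ,…,δ)` (`m` times)" (BI 2017 §5, L2024), via the tree's
`kroneckerCoeff` and `Nat.Partition.rectangle`. [cite: BurgisserIkenmeyer2017, §5 (before eq. (5.2))] -/
def kronRect (k : Type*) [Field k] (m δ : ℕ) : ℕ :=
  kroneckerCoeff k (Nat.Partition.rectangle m δ) (Nat.Partition.rectangle m δ)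
    (Nat.Partition.rectangle m δ)

end TensorInvariants

/-! ### §5 Theorems 5.3, 5.8 and the Kronecker description (named facts) -/

section TensorMonoidFacts

/-- **BI 2017, Lemma 5.1(3) / "`E(w) = m a(w) E'(w)`"** (L1954–1975, L1996: "Again we have
`E(w) = m a(w) E'(w)` with the exponent monoid …"), for a polystable nonzero tensor `w ∈ ⊗³ℂ^m`;
also `e(w) = m a(w) e'(w)`. (Lemma 5.1(1)(2), on `φ_w` and the coordinate ring `O(Gw)` of the orbit,
are not typed.) [cite: BurgisserIkenmeyer2017, Lemma 5.1(3)] -/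
def BI2017_lem_5_1_3 : Prop :=
  ∀ (m : ℕ) (w : Fin m → Fin m → Fin m → ℂ), w ≠ 0 → IsPolystableTensor w →
    tensorDegreeMonoid w =
        (fun e => m * tensorStabilizerPeriod w * e) '' tensorExponentMonoid w ∧
      tensorMinimalDegree w = m * tensorStabilizerPeriod w * tensorMinimalExponent w

/-- **BI 2017, Thm. 5.3** (L1990, p0018:L43; proof in §6.4): "The degree monoid `E(w)` generates the
group `m a(w) ℤ`" — for a polystable tensor `w` ("Throughout this section, we assume that
`w ∈ ⊗³ℂ^m` is polystable", L1947), here nonzero. [cite: BurgisserIkenmeyer2017, Thm. 5.3] -/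
def BI2017_thm_5_3 : Prop :=
  ∀ (m : ℕ) (w : Fin m → Fin m → Fin m → ℂ), w ≠ 0 → IsPolystableTensor w →
    AddSubgroup.closure ((fun d : ℕ => (d : ℤ)) '' tensorDegreeMonoid w) =
      AddSubgroup.zmultiples ((m * tensorStabilizerPeriod w : ℕ) : ℤ)

/-- **BI 2017, "`E(w) = E(m)`, and hence `e(w) = e(m)`, for almost all `w ∈ ⊗³ℂ^m`"** (L2012).
[cite: BurgisserIkenmeyer2017, §5 (after eq. (5.1))] -/
def BI2017_tensorDegreeMonoid_generic : Prop :=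
  ∀ m : ℕ, IsZariskiGenericTensor fun w : Fin m → Fin m → Fin m → ℂ =>
    tensorDegreeMonoid w = genericTensorDegreeMonoid (Fin m) ℂ ∧
      tensorMinimalDegree w = genericTensorMinimalDegree (Fin m) ℂ

/-- **BI 2017, §5, the dimension formula** (L2019–2026): "It is a well-known fact, e.g., see
[Landsberg–Manivel 2004], that `dim O(⊗³ℂ^m)^{SL^3_m}_{mδ} = k_m(δ)`." (`m ≥ 1`.)
[cite: BurgisserIkenmeyer2017, §5 (before eq. (5.2))] -/
def BI2017_dim_sl3Invariants : Prop :=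
  ∀ (m δ : ℕ), 1 ≤ m →
    Module.finrank ℂ (sl3InvariantsOfDegree (Fin m) ℂ (m * δ)) = kronRect ℂ m δ

/-- **BI 2017, eq. (5.2)** (L2029): "`E'(m) = {δ ∈ ℕ | k_m(δ) > 0}` if `m > 2`", where
`E'(m) = E(m)/(m a(m))` and `a(m) = 1` for `m > 2` (Thm. 4.2); typed as
`E(m) = {m δ | k_m(δ) > 0}`. [cite: BurgisserIkenmeyer2017, §5 eq. (5.2)] -/
def BI2017_eq_5_2 : Prop :=
  ∀ m : ℕ, 2 < m →
    genericTensorDegreeMonoid (Fin m) ℂ = {d | ∃ δ : ℕ, d = m * δ ∧ 0 < kronRect ℂ m δ}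

/-- **BI 2017, Rem. 5.4** (L2033, p0018:L92): "The case `m = 2` is special since `a(2) = 2`. Here we
have `{δ ∈ ℕ | k_2(δ) > 0} = 2E'(2) = 2ℕ`. In fact, it is known that `k_2(δ)` equals `1` if `δ` is
even and `k_2(δ) = 0` otherwise; cf. [Remmel–Whitehead 1994]." With `E(2) = 2 a(2) E'(2) = 4 E'(2)`:
`E(2) = 4ℕ`. [cite: BurgisserIkenmeyer2017, Rem. 5.4] -/
def BI2017_rem_5_4 : Prop :=
  (∀ δ : ℕ, kronRect ℂ 2 δ = if Even δ then 1 else 0) ∧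
  genericTensorDegreeMonoid (Fin 2) ℂ = {d | 4 ∣ d}

/-- **BI 2017, Example 5.5** (L2041, p0018:L98; SCHUR computation, Vinberg 1976, Strassen 1983):
"The generic exponent monoid `E'(3) = {0,2,3,4,…}` is generated by `2,3`. Thus `1` is the only gap.
The first function values of `k_3` are given by `k_3(0..12) = 1,0,1,1,2,1,3,2,4,3,5,4,7`. … We also
remark that `k_3(3) = 1` states the existence and uniqueness of Strassen's invariant." Typed: the
table of `k_3` and `E(3) = {3δ | δ ≠ 1}` (via `E(3) = 3 E'(3)`). [cite: BurgisserIkenmeyer2017, Ex. 5.5] -/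
def BI2017_ex_5_5 : Prop :=
  (kronRect ℂ 3 0 = 1 ∧ kronRect ℂ 3 1 = 0 ∧ kronRect ℂ 3 2 = 1 ∧ kronRect ℂ 3 3 = 1 ∧
    kronRect ℂ 3 4 = 2 ∧ kronRect ℂ 3 5 = 1 ∧ kronRect ℂ 3 6 = 3 ∧ kronRect ℂ 3 7 = 2 ∧
    kronRect ℂ 3 8 = 4 ∧ kronRect ℂ 3 9 = 3 ∧ kronRect ℂ 3 10 = 5 ∧ kronRect ℂ 3 11 = 4 ∧
    kronRect ℂ 3 12 = 7) ∧
  genericTensorDegreeMonoid (Fin 3) ℂ = {d | ∃ δ : ℕ, d = 3 * δ ∧ δ ≠ 1}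

/-- **BI 2017, Example 5.6 and Rem. 5.18** (L2069, p0018:L125; L2379; computations with the DERKSEN
program): "`E'(4) = E'(3) = {0,2,3,4,…}` …; `E'(5) = E'(6) = E'(8) = E'(9) = {0,3,4,5,6,…}` …;
`E'(7) = {0,4,5,6,7,8,…}` …; `e'(3) = e'(4) = 2`, `e'(5) = e'(6) = e'(8) = e'(9) = 3`, `e'(7) = 4`;
`E'(10) = E'(11) = E'(12) = {0,4,5,6,7,…}` and hence `e'(10) = e'(11) = e'(12) = 4`. Further,
`e'(13) = e'(14) = e'(15) = e'(16) = 4`." Rem. 5.18: "`k_m(e'(m)) = 1` for `m = 2,3,4,5,6,8,9,14,15,16`,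
but `k_7(4) = 14`, `k_{10}(4) = 13`, `k_{11}(4) = 6`, `k_{12}(e'(12)) = 5`, `k_{13}(e'(13)) = 2`."
Typed through `e(m) = m e'(m)` (`m > 2`, `a(m) = 1`) and `E(m) = m E'(m)`; the "verified for
`m ≤ 12`" range of Problem 5.19 (L2393: `E'(m) = {0} ∪ (e'(m) + ℕ)`) is the shape of the listed sets.
[cite: BurgisserIkenmeyer2017, Ex. 5.6 and Rem. 5.18] -/
def BI2017_ex_5_6 : Prop :=
  genericTensorMinimalDegree (Fin 3) ℂ = 6 ∧ genericTensorMinimalDegree (Fin 4) ℂ = 8 ∧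
  genericTensorMinimalDegree (Fin 5) ℂ = 15 ∧ genericTensorMinimalDegree (Fin 6) ℂ = 18 ∧
  genericTensorMinimalDegree (Fin 7) ℂ = 28 ∧ genericTensorMinimalDegree (Fin 8) ℂ = 24 ∧
  genericTensorMinimalDegree (Fin 9) ℂ = 27 ∧ genericTensorMinimalDegree (Fin 10) ℂ = 40 ∧
  genericTensorMinimalDegree (Fin 11) ℂ = 44 ∧ genericTensorMinimalDegree (Fin 12) ℂ = 48 ∧
  genericTensorMinimalDegree (Fin 13) ℂ = 52 ∧ genericTensorMinimalDegree (Fin 14) ℂ = 56 ∧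
  genericTensorMinimalDegree (Fin 15) ℂ = 60 ∧ genericTensorMinimalDegree (Fin 16) ℂ = 64 ∧
  (∀ m : ℕ, 3 ≤ m → m ≤ 12 →
    genericTensorDegreeMonoid (Fin m) ℂ =
      {d | d = 0 ∨ ∃ δ : ℕ, d = m * δ ∧ genericTensorMinimalDegree (Fin m) ℂ ≤ m * δ}) ∧
  (kronRect ℂ 4 2 = 1 ∧ kronRect ℂ 5 3 = 1 ∧ kronRect ℂ 6 3 = 1 ∧ kronRect ℂ 8 3 = 1 ∧
    kronRect ℂ 9 3 = 1 ∧ kronRect ℂ 14 4 = 1 ∧ kronRect ℂ 15 4 = 1 ∧ kronRect ℂ 16 4 = 1 ∧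
    kronRect ℂ 7 4 = 14 ∧ kronRect ℂ 10 4 = 13 ∧ kronRect ℂ 11 4 = 6 ∧ kronRect ℂ 12 4 = 5 ∧
    kronRect ℂ 13 4 = 2)

/-- **BI 2017, Thm. 5.8 (1), (3)** (L2097, p0018:L150; "completely analogous to Prop. 3.9 and
Thm. 3.10"): "1. The zero set of `Φ_w` in `\overline{Gw}` equals the boundary `\overline{Gw} ∖ Gw`. …
3. If `m a(w) < e(w)`, that is, `1 < e'(w)`, then the vanishing ideal of the boundary
`\overline{Gw} ∖ Gw` in `\overline{Gw}` is strictly larger than the principal ideal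
`Φ_w O(\overline{Gw})`. Moreover, `\overline{Gw}` is not a normal algebraic variety." (`w ≠ 0`
polystable; part 2, `O(Gw) = O(\overline{Gw})_{Φ_w}`, and "not a valuation ring" are not typed.)
[cite: BurgisserIkenmeyer2017, Thm. 5.8] -/
def BI2017_thm_5_8 : Prop :=
  ∀ (m : ℕ) (w : Fin m → Fin m → Fin m → ℂ) (Φ : MvPolynomial (Fin m × Fin m × Fin m) ℂ),
    w ≠ 0 → IsPolystableTensor w → IsTensorFundamentalInvariant w Φ →
    (∀ v ∈ closure (tensorGLOrbit w), aeval (tensorPt v) Φ = 0 ↔ v ∉ tensorGLOrbit w) ∧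
    (m * tensorStabilizerPeriod w < tensorMinimalDegree w →
      Ideal.span {Ideal.Quotient.mk (tensorOrbitVanishingIdeal w) Φ} <
          (tensorBoundaryVanishingIdeal w).map (Ideal.Quotient.mk (tensorOrbitVanishingIdeal w)) ∧
      ¬ IsIntegrallyClosed (TensorOrbitCoordRing w))

end TensorMonoidFacts

/-! ### §5.1 The generic fundamental invariant `F_n` of `⊗³ℂ^{n²}` -/

section FundamentalInvariantTensor

variable (n : ℕ)

/-- The `ℓ`-th `x`-slice `{ℓ} × [n] × [n]` of the combinatorial cube `[n]³`, read through a labeling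
`α : [n]³ → [n²]` as a map `[n²] → [n²]` (the fixed total ordering of a slice being
`finProdFinEquiv : [n] × [n] ≃ [n²]`; BI 2017 §5.1, L2238–2252). [cite: BurgisserIkenmeyer2017, §5.1 (before eq. (5.5))] -/
def xSliceMap (α : Fin n × Fin n × Fin n → Fin (n * n)) (ℓ : Fin n) : Fin (n * n) → Fin (n * n) :=
  fun q => α (ℓ, finProdFinEquiv.symm q)

/-- The `ℓ`-th `y`-slice (second coordinate fixed) of a labeling. [cite: BurgisserIkenmeyer2017, §5.1 (before eq. (5.5))] -/
def ySliceMap (α : Fin n × Fin n × Fin n → Fin (n * n)) (ℓ : Fin n) : Fin (n * n) → Fin (n * n) :=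
  fun q => α ((finProdFinEquiv.symm q).1, ℓ, (finProdFinEquiv.symm q).2)

/-- The `ℓ`-th `z`-slice (third coordinate fixed) of a labeling. [cite: BurgisserIkenmeyer2017, §5.1 (before eq. (5.5))] -/
def zSliceMap (α : Fin n × Fin n × Fin n → Fin (n * n)) (ℓ : Fin n) : Fin (n * n) → Fin (n * n) :=
  fun q => α ((finProdFinEquiv.symm q).1, (finProdFinEquiv.symm q).2, ℓ)

open Classical in
/-- The sign `sgn(α) ∈ {-1, 0, 1}` of a family of slices: "Suppose that a labeling defines a
bijection on each `x`-slice. Then the resulting permutation of each `x`-slice has a well-defined sign.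
We define `sgn_x(α)` … to be the product of the signs of the permutations of all `x`-slices. If the
labeling `α` fails to be a bijection on an `x`-slice, we write `sgn_x(α) := 0`." (BI 2017 §5.1,
L2246–2252; `Kumar2015.seqSign` = the sign of a sequence.) [cite: BurgisserIkenmeyer2017, §5.1 (before eq. (5.5))] -/
def sliceSign (s : Fin n → Fin (n * n) → Fin (n * n)) : ℤ :=
  if ∀ ℓ, Function.Bijective (s ℓ) then ∏ ℓ, ((Kumar2015.seqSign (s ℓ) : ℤˣ) : ℤ) else 0

/-- `sgn_x(α)`. [cite: BurgisserIkenmeyer2017, §5.1 (before eq. (5.5))] -/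
def labelSignX (α : Fin n × Fin n × Fin n → Fin (n * n)) : ℤ := sliceSign n (xSliceMap n α)

/-- `sgn_y(β)`. [cite: BurgisserIkenmeyer2017, §5.1 (before eq. (5.5))] -/
def labelSignY (α : Fin n × Fin n × Fin n → Fin (n * n)) : ℤ := sliceSign n (ySliceMap n α)

/-- `sgn_z(γ)`. [cite: BurgisserIkenmeyer2017, §5.1 (before eq. (5.5))] -/
def labelSignZ (α : Fin n × Fin n × Fin n → Fin (n * n)) : ℤ := sliceSign n (zSliceMap n α)

/-- **The generic fundamental invariant of tensors** `F_n : ⊗³k^{n²} → k` (BI 2017 eq. (5.5), L2258):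
`F_n(w) := ∑_{α,β,γ : [n]³ → [n²]} sgn_x(α) sgn_y(β) sgn_z(γ) ∏_{p ∈ [n]³} w_{α(p)β(p)γ(p)}`, a
homogeneous polynomial of degree `n³` in the coordinates `w_{abc}`, `a,b,c ∈ [n²] = Fin (n*n)`.
[cite: BurgisserIkenmeyer2017, §5.1 eq. (5.5)] -/
def fundInvariantTensor (k : Type*) [Field k] :
    MvPolynomial (Fin (n * n) × Fin (n * n) × Fin (n * n)) k :=
  ∑ α : Fin n × Fin n × Fin n → Fin (n * n), ∑ β : Fin n × Fin n × Fin n → Fin (n * n),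
    ∑ γ : Fin n × Fin n × Fin n → Fin (n * n),
      C ((labelSignX n α * labelSignY n β * labelSignZ n γ : ℤ) : k) *
        ∏ p : Fin n × Fin n × Fin n, X (α p, β p, γ p)

/-- **BI 2017, Def. 5.21 (Latin cube)** (L2421, p0021:L88): "A Latin cube of size `n` is a map
`α : [n]³ → [n²]` that is a bijection on each of the `x`-slices, `y`-slices, and `z`-slices of the
combinatorial cube `[n]³`." [cite: BurgisserIkenmeyer2017, Def. 5.21] -/
def IsLatinCube (α : Fin n × Fin n × Fin n → Fin (n * n)) : Prop :=
  (∀ ℓ, Function.Bijective (xSliceMap n α ℓ)) ∧ (∀ ℓ, Function.Bijective (ySliceMap n α ℓ)) ∧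
    ∀ ℓ, Function.Bijective (zSliceMap n α ℓ)

/-- The sign of a Latin cube: "even if the product of the signs of the resulting permutations of
all `x`-slices, `y`-slices, and `z`-slices equals one. Otherwise … odd" (BI 2017 Def. 5.21, L2425).
[cite: BurgisserIkenmeyer2017, Def. 5.21] -/
def latinCubeSign (α : Fin n × Fin n × Fin n → Fin (n * n)) : ℤ :=
  labelSignX n α * labelSignY n α * labelSignZ n α

open Classical in
/-- `#{even Latin cubes of size n} − #{odd Latin cubes of size n}` (BI 2017 Prop. 5.22, Problem 5.23).
[cite: BurgisserIkenmeyer2017, Prop. 5.22] -/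
def latinCubeCount : ℤ :=
  ∑ α ∈ (Finset.univ : Finset (Fin n × Fin n × Fin n → Fin (n * n))).filter (fun α => IsLatinCube n α),
    latinCubeSign n α

/-- `⟨n,n,n⟩` as a tensor over `[n²] = Fin (n*n)` (indices `(i,j) ↦ finProdFinEquiv (i,j)`), the
format in which `F_n` is evaluated at it (BI 2017 Prop. 5.24, L2463–2470).
[cite: BurgisserIkenmeyer2017, Prop. 5.24] -/
def biMatMulTensorFin (k : Type*) [Field k] : Fin (n * n) → Fin (n * n) → Fin (n * n) → k :=
  fun a b c => biMatMulTensor k n (finProdFinEquiv.symm a) (finProdFinEquiv.symm b)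
    (finProdFinEquiv.symm c)

end FundamentalInvariantTensor

/-! ### §5.1–§5.2 Theorems 5.9, 5.11, 5.13 and their corollaries (named facts) -/

section FundamentalInvariantTensorFacts

/-- **BI 2017, Thm. 5.9** (L2122, p0019:L3): "1. We have `⌈√m⌉ ≤ e'(m)` if `m > 2`. 2. We have
`e'(m) ≤ m` if the Alon-Tarsi [statement `AT(m)`] holds for `m`. 3. If `m = n²`, then
`k_{n²}(n) = 1`. In particular, `e'(n²) = n`." Typed with `e'(m) = e(m)/m` for `m > 2` (`a(m) = 1`,
Thm. 4.2): (1) `m ≤ (e(m)/m)²` and `m ∣ e(m)`; (2) for `m > 2`, `AT(m)` (`Kumar2015.latinColCount m ≠ 0`,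
`KumarLatinRectangles.lean`) implies `e(m) ≤ m²`; (3) `k_{n²}(n) = 1` for `n ≥ 1` and
`e(n²) = n³` for `n ≥ 2`. [cite: BurgisserIkenmeyer2017, Thm. 5.9] -/
def BI2017_thm_5_9 : Prop :=
  (∀ m : ℕ, 2 < m →
    m ∣ genericTensorMinimalDegree (Fin m) ℂ ∧ m ≤ (genericTensorMinimalDegree (Fin m) ℂ / m) ^ 2) ∧
  (∀ m : ℕ, 2 < m → Kumar2015.latinColCount m ≠ 0 → genericTensorMinimalDegree (Fin m) ℂ ≤ m * m) ∧
  (∀ n : ℕ, 1 ≤ n → kronRect ℂ (n * n) n = 1) ∧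
  (∀ n : ℕ, 2 ≤ n → genericTensorMinimalDegree (Fin (n * n)) ℂ = n * n * n)

/-- **BI 2017, Thm. 5.11** (L2216, p0019:L102; "analogous to Theorem 3.15"): "Assume `w ∈ ⊗³ℂ^m` is
polystable. Then `√m / a(w) ≤ e'(w)` if `m > 2`. Moreover, if `m = n²`, we have equality iff
`F_n(w) ≠ 0`. In this case, we have `Φ_w = F_n(w)⁻¹ F_n` on `\overline{Gw}`." (`w ≠ 0`;
`√m/a(w) ≤ e'(w)` ⟺ `m ≤ (a(w) e'(w))²`; for `m = n²` equality means `a(w) e'(w) = n`.)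
[cite: BurgisserIkenmeyer2017, Thm. 5.11] -/
def BI2017_thm_5_11 : Prop :=
  (∀ (m : ℕ) (w : Fin m → Fin m → Fin m → ℂ), 2 < m → w ≠ 0 → IsPolystableTensor w →
    m ≤ (tensorStabilizerPeriod w * tensorMinimalExponent w) ^ 2) ∧
  ∀ (n : ℕ) (w : Fin (n * n) → Fin (n * n) → Fin (n * n) → ℂ), 2 ≤ n → w ≠ 0 →
    IsPolystableTensor w →
    (tensorStabilizerPeriod w * tensorMinimalExponent w = n ↔
      aeval (tensorPt w) (fundInvariantTensor n ℂ) ≠ 0) ∧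
    (aeval (tensorPt w) (fundInvariantTensor n ℂ) ≠ 0 →
      IsTensorFundamentalInvariant w
        (C (aeval (tensorPt w) (fundInvariantTensor n ℂ))⁻¹ * fundInvariantTensor n ℂ))

/-- **BI 2017, Cor. 5.12** (L2227, p0019:L112): "1. `\overline{Gw}` is not normal if `a(w) < √m`.
2. Let `m ≥ 3`. Then `\overline{Gw}` is not normal for almost all `w ∈ ⊗³ℂ^m`." (Part 1 for `w ≠ 0`
polystable with `m > 2`, the range of Thm. 5.11 from which it is "immediate", and finite period:
`0 < a(w)`, `a(w)² < m`. The text notes that for `m = 2` generic orbit closures equal `⊗³ℂ²` and are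
normal.) [cite: BurgisserIkenmeyer2017, Cor. 5.12] -/
def BI2017_cor_5_12 : Prop :=
  (∀ (m : ℕ) (w : Fin m → Fin m → Fin m → ℂ), 2 < m → w ≠ 0 → IsPolystableTensor w →
    0 < tensorStabilizerPeriod w → tensorStabilizerPeriod w ^ 2 < m →
    ¬ IsIntegrallyClosed (TensorOrbitCoordRing w)) ∧
  ∀ m : ℕ, 3 ≤ m →
    IsZariskiGenericTensor fun w : Fin m → Fin m → Fin m → ℂ =>
      ¬ IsIntegrallyClosed (TensorOrbitCoordRing w)

/-- **BI 2017, Thm. 5.13** (L2266, p0020:L33; cf. Bürgisser–Ikenmeyer 2013 Ex. 4.12): "We have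
`F_n((g_1 ⊗ g_2 ⊗ g_3)w) = (det(g_1)det(g_2)det(g_3))^n F_n(w)` for all `(g_1,g_2,g_3) ∈ GL_{n²}` and
`w ∈ ⊗³ℂ^{n²}`. Moreover, `F_n ≠ 0`." (`n ≥ 1`.) [cite: BurgisserIkenmeyer2017, Thm. 5.13] -/
def BI2017_thm_5_13 : Prop :=
  ∀ n : ℕ, 1 ≤ n →
    (∀ (g : GL (Fin (n * n)) ℂ × GL (Fin (n * n)) ℂ × GL (Fin (n * n)) ℂ)
        (w : Fin (n * n) → Fin (n * n) → Fin (n * n) → ℂ),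
      aeval (tensorPt (actTensor (g.1 : Matrix (Fin (n * n)) (Fin (n * n)) ℂ)
          (g.2.1 : Matrix (Fin (n * n)) (Fin (n * n)) ℂ) (g.2.2 : Matrix (Fin (n * n)) (Fin (n * n)) ℂ)
          w)) (fundInvariantTensor n ℂ) =
        ((tensorChi g : ℂˣ) : ℂ) ^ n * aeval (tensorPt w) (fundInvariantTensor n ℂ)) ∧
    fundInvariantTensor n ℂ ≠ 0

/-- **BI 2017, after Thm. 5.13** (L2345): "As for Lemma 3.19, we can show that the generic
fundamental invariant `F_n` is an irreducible polynomial." (`n ≥ 1`.) [cite: BurgisserIkenmeyer2017, §5.1 (after Thm. 5.13)] -/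
def BI2017_fundInvariantTensor_irreducible : Prop :=
  ∀ n : ℕ, 1 ≤ n → Irreducible (fundInvariantTensor n ℂ)

/-- **BI 2017, Prop. 5.22** (L2432, p0021:L97): "1. `F_n(⟨n²⟩)` equals the difference between the
number of even Latin cubes of size `n` and the number of odd Latin cubes of size `n`. 2. We have
`F_n(⟨n²⟩) = 0` if `n` is odd." (The unit tensor `⟨n²⟩ = ∑_a |aaa⟩ ∈ ⊗³ℂ^{n²}` has `0/1` entries, so
part 1 is an exact identity. Part 2 for odd `n ≥ 3`: the printed involution exchanges two of the
`n²` symbols, and for `n = 1` indeed `F_1(⟨1⟩) = 1`.) [cite: BurgisserIkenmeyer2017, Prop. 5.22] -/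
def BI2017_prop_5_22 : Prop :=
  ∀ n : ℕ,
    aeval (tensorPt (unitTensor ℂ (n * n))) (fundInvariantTensor n ℂ) = (latinCubeCount n : ℂ) ∧
    (Odd n → 1 < n → aeval (tensorPt (unitTensor ℂ (n * n))) (fundInvariantTensor n ℂ) = 0)

/-- **BI 2017, Problem 5.23 — the verified cases** (L2449–2451): Problem 5.23 ("Let `n` be even. Is
the number of even Latin cubes of size `n` different from the number of odd Latin cubes of size
`n`?", a 3D analogue of Alon–Tarsi) is OPEN and not typed; the source states "We have verified this
in the cases `n = 2` and `n = 4`" (a computer verification). [cite: BurgisserIkenmeyer2017, §5.2 (before Problem 5.23)] -/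
def BI2017_latinCube_2_4 : Prop :=
  latinCubeCount 2 ≠ 0 ∧ latinCubeCount 4 ≠ 0

/-- **BI 2017, Prop. 5.24** (L2470, p0021:L131): "We have
`F_n(⟨n,n,n⟩) = ∑_{μ,ν,π : [n]³ → [n]} sgn_x(μ,ν) sgn_y(ν,π) sgn_z(π,μ)`", a labeling
`[n]³ → [n]²` being given by its two coordinate maps (`(μ,ν)(p) = (μ(p), ν(p))`, here encoded into
`[n²]` by `finProdFinEquiv`); `⟨n,n,n⟩ = ∑ |(ij)(jk)(ki)⟩` (`biMatMulTensorFin`).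
[cite: BurgisserIkenmeyer2017, Prop. 5.24] -/
def BI2017_prop_5_24 : Prop :=
  ∀ n : ℕ,
    aeval (tensorPt (biMatMulTensorFin n ℂ)) (fundInvariantTensor n ℂ) =
      ∑ μ : Fin n × Fin n × Fin n → Fin n, ∑ ν : Fin n × Fin n × Fin n → Fin n,
        ∑ π : Fin n × Fin n × Fin n → Fin n,
          ((labelSignX n (fun p => finProdFinEquiv (μ p, ν p)) *
            labelSignY n (fun p => finProdFinEquiv (ν p, π p)) *
            labelSignZ n (fun p => finProdFinEquiv (π p, μ p)) : ℤ) : ℂ)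

/-- **BI 2017, Cor. 5.25** (L2478, p0022:L5): "1. We have `e'(⟨m⟩) ≥ ½⌈√m⌉` if `m > 1`. 2. Let
`m = n²` be even. Then `e'(⟨n²⟩) = n/2` iff the number of even Latin cubes of size `n` is different
from the number of odd Latin cubes of size `n`. 3. We have `e'(⟨n,n,n⟩) ≥ n`, with equality holding
iff `F_n(⟨n,n,n⟩) ≠ 0`." (1: `2e' ≥ ⌈√m⌉` ⟺ `m ≤ 4 e'²`; 2: `n ≥ 2` even; 3: `n ≥ 1`.)
[cite: BurgisserIkenmeyer2017, Cor. 5.25] -/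
def BI2017_cor_5_25 : Prop :=
  (∀ m : ℕ, 1 < m → m ≤ 4 * tensorMinimalExponent (unitTensor ℂ m) ^ 2) ∧
  (∀ n : ℕ, 2 ≤ n → Even n →
    (tensorMinimalExponent (unitTensor ℂ (n * n)) = n / 2 ↔ latinCubeCount n ≠ 0)) ∧
  ∀ n : ℕ, 1 ≤ n →
    n ≤ tensorMinimalExponent (biMatMulTensorFin n ℂ) ∧
    (tensorMinimalExponent (biMatMulTensorFin n ℂ) = n ↔
      aeval (tensorPt (biMatMulTensorFin n ℂ)) (fundInvariantTensor n ℂ) ≠ 0)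

/-- **BI 2017, Cor. 5.26** (L2497, p0022:L24; already in Bürgisser–Ikenmeyer 2011): "The orbit
closure of the unit tensor `⟨m⟩` is not normal if `m ≥ 5`. The orbit closure of the matrix
multiplication tensor `⟨n,n,n⟩` is not normal if `n ≥ 2`." (`GL³`-orbit closures in `⊗³ℂ^m`, resp.
`⊗³ℂ^{n×n}`; normality = integrally closed coordinate ring.) [cite: BurgisserIkenmeyer2017, Cor. 5.26] -/
def BI2017_cor_5_26 : Prop :=
  (∀ m : ℕ, 5 ≤ m → ¬ IsIntegrallyClosed (TensorOrbitCoordRing (unitTensor ℂ m))) ∧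
  ∀ n : ℕ, 2 ≤ n → ¬ IsIntegrallyClosed (TensorOrbitCoordRing (biMatMulTensor ℂ n))

end FundamentalInvariantTensorFacts

/-! ### Proofs supplied by the second typing (val-lit row BI2017-B, t06): Cor. 4.9 for `⟨m⟩`,
the easy half of Thm. 4.5, and Problem 5.23 as a neutral predicate

The statements above are the file of record (t04, p420130). This section adds PROOFS in the
vocabulary already fixed above, plus the neutral (parametrised, unasserted) predicate
`latinCubeQuestion` naming the open Problem 5.23; nothing is restated. Bridge used throughout:
`actTensor` (`QuantumFunctionals.lean`) and `tripleAct` (`MatMulPolystableProofs.lean`, the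
spelling of the tree's Kempf–Ness criterion `isClosed_tripleOrbit_of_gram`) are the same function. -/

section SecondTypingProofs

open Matrix

variable {ι : Type*} [Fintype ι] [DecidableEq ι]

omit [DecidableEq ι] in
/-- `actTensor` and `tripleAct` are the same factorwise action `(A ⊗ B ⊗ C)·t` (definitionally).
[cite: BurgisserIkenmeyer2017, §4 (the action of `GL_m^3` on `⊗³ℂ^m`)] -/
theorem actTensor_eq_tripleAct (A B C : Matrix ι ι ℂ) (t : ι → ι → ι → ℂ) :
    actTensor A B C t = tripleAct A B C t :=
  rfl

/-- The `SL³`-orbit in `IsPolystableTensor`, as the set of tensors with three determinant-one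
witnesses (the shape of `isClosed_tripleOrbit_of_gram`). [cite: BurgisserIkenmeyer2017, §4.2] -/
theorem range_sl3_actTensor_eq (w : ι → ι → ι → ℂ) :
    (Set.range fun g : Matrix.SpecialLinearGroup ι ℂ × Matrix.SpecialLinearGroup ι ℂ ×
        Matrix.SpecialLinearGroup ι ℂ =>
      actTensor (g.1 : Matrix ι ι ℂ) (g.2.1 : Matrix ι ι ℂ) (g.2.2 : Matrix ι ι ℂ) w) =
    {s | ∃ A B C : Matrix ι ι ℂ, A.det = 1 ∧ B.det = 1 ∧ C.det = 1 ∧ tripleAct A B C w = s} := by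
  ext s
  simp only [Set.mem_range, Set.mem_setOf_eq, Prod.exists]
  constructor
  · rintro ⟨A, B, C, rfl⟩
    exact ⟨A, B, C, A.2, B.2, C.2, rfl⟩
  · rintro ⟨A, B, C, hA, hB, hC, rfl⟩
    exact ⟨⟨A, hA⟩, ⟨B, hB⟩, ⟨C, hC⟩, rfl⟩

/-- Polystability through the Kempf–Ness criterion of `MatMulPolystableProofs.lean`: a tensor
whose three one-leg Gram matrices are the same scalar and which is concise in each leg is
polystable (the Kempf–Ness form of the polystability test of §4.2; the paper's own test is Prop. 4.8).
[cite: BurgisserIkenmeyer2017, §4.2 (polystability criterion, cf. Prop. 4.8)] -/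
theorem isPolystableTensor_of_gram (w : ι → ι → ι → ℂ) {cst : ℂ}
    (hG1 : ∀ a a' : ι, ∑ b, ∑ c, (starRingEnd ℂ) (w a' b c) * w a b c = if a = a' then cst else 0)
    (hG2 : ∀ b b' : ι, ∑ a, ∑ c, (starRingEnd ℂ) (w a b' c) * w a b c = if b = b' then cst else 0)
    (hG3 : ∀ c c' : ι, ∑ a, ∑ b, (starRingEnd ℂ) (w a b c') * w a b c = if c = c' then cst else 0)
    (h1 : ∀ v : ι → ℂ, (∀ b c, ∑ a, v a * w a b c = 0) → v = 0)
    (h2 : ∀ v : ι → ℂ, (∀ a c, ∑ b, v b * w a b c = 0) → v = 0)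
    (h3 : ∀ v : ι → ℂ, (∀ a b, ∑ c, v c * w a b c = 0) → v = 0) :
    IsPolystableTensor w := by
  unfold IsPolystableTensor
  rw [range_sl3_actTensor_eq]
  exact isClosed_tripleOrbit_of_gram w hG1 hG2 hG3 h1 h2 h3

/-- Off-diagonal vanishing of `⟨m⟩`, first/second index. [cite: BurgisserIkenmeyer2017, §4.1 (the unit tensor)] -/
private theorem unitTensor_eq_zero₁₂ {m : ℕ} {a b : Fin m} (h : a ≠ b) (c : Fin m) :
    unitTensor ℂ m a b c = 0 := by
  rw [unitTensor_apply, if_neg]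
  exact fun hh => h hh.1

/-- Off-diagonal vanishing of `⟨m⟩`, second/third index. [cite: BurgisserIkenmeyer2017, §4.1 (the unit tensor)] -/
private theorem unitTensor_eq_zero₂₃ {m : ℕ} (a : Fin m) {b c : Fin m} (h : b ≠ c) :
    unitTensor ℂ m a b c = 0 := by
  rw [unitTensor_apply, if_neg]
  exact fun hh => h hh.2

/-- Off-diagonal vanishing of `⟨m⟩`, first/third index. [cite: BurgisserIkenmeyer2017, §4.1 (the unit tensor)] -/
private theorem unitTensor_eq_zero₁₃ {m : ℕ} {a c : Fin m} (h : a ≠ c) (b : Fin m) :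
    unitTensor ℂ m a b c = 0 := by
  rw [unitTensor_apply, if_neg]
  exact fun hh => h (hh.1.trans hh.2)

/-- First Gram matrix of `⟨m⟩`: `∑_{b,c} conj ⟨m⟩_{a'bc} ⟨m⟩_{abc} = δ_{aa'}` — the moment-map form
of the printed input "the marginals of the uniform distribution on `supp ⟨m⟩` are uniform" (proof
of Cor. 4.9). [cite: BurgisserIkenmeyer2017, Cor. 4.9 (proof)] -/
private theorem gram_unitTensor₁ {m : ℕ} (a a' : Fin m) :
    ∑ b, ∑ c, (starRingEnd ℂ) (unitTensor ℂ m a' b c) * unitTensor ℂ m a b c =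
      if a = a' then (1 : ℂ) else 0 := by
  rw [Finset.sum_eq_single a, Finset.sum_eq_single a]
  · by_cases h : a = a'
    · subst h; simp
    · rw [if_neg h, unitTensor_eq_zero₁₂ (Ne.symm h), map_zero, zero_mul]
  · intro c _ hc; rw [unitTensor_eq_zero₂₃ a (Ne.symm hc), mul_zero]
  · simp
  · intro b _ hb
    exact Finset.sum_eq_zero fun c _ => by rw [unitTensor_eq_zero₁₂ (Ne.symm hb), mul_zero]
  · simp

/-- Second Gram matrix of `⟨m⟩`. [cite: BurgisserIkenmeyer2017, Cor. 4.9 (proof)] -/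
private theorem gram_unitTensor₂ {m : ℕ} (b b' : Fin m) :
    ∑ a, ∑ c, (starRingEnd ℂ) (unitTensor ℂ m a b' c) * unitTensor ℂ m a b c =
      if b = b' then (1 : ℂ) else 0 := by
  rw [Finset.sum_eq_single b, Finset.sum_eq_single b]
  · by_cases h : b = b'
    · subst h; simp
    · rw [if_neg h, unitTensor_eq_zero₁₂ h, map_zero, zero_mul]
  · intro c _ hc; rw [unitTensor_eq_zero₂₃ b (Ne.symm hc), mul_zero]
  · simp
  · intro a _ ha
    exact Finset.sum_eq_zero fun c _ => by rw [unitTensor_eq_zero₁₂ ha, mul_zero]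
  · simp

/-- Third Gram matrix of `⟨m⟩`. [cite: BurgisserIkenmeyer2017, Cor. 4.9 (proof)] -/
private theorem gram_unitTensor₃ {m : ℕ} (c c' : Fin m) :
    ∑ a, ∑ b, (starRingEnd ℂ) (unitTensor ℂ m a b c') * unitTensor ℂ m a b c =
      if c = c' then (1 : ℂ) else 0 := by
  rw [Finset.sum_eq_single c, Finset.sum_eq_single c]
  · by_cases h : c = c'
    · subst h; simp
    · rw [if_neg h, unitTensor_eq_zero₂₃ c h, map_zero, zero_mul]
  · intro b _ hb; rw [unitTensor_eq_zero₂₃ c hb, mul_zero]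
  · simp
  · intro a _ ha
    exact Finset.sum_eq_zero fun b _ => by rw [unitTensor_eq_zero₁₃ ha, mul_zero]
  · simp

/-- **BI 2017, Cor. 4.9 for the unit tensors — PROVED**: "The unit tensors `⟨m⟩` … are
polystable." Discharges `BI2017_cor_4_9_unitTensor` by the tree's Kempf–Ness criterion
(`isClosed_tripleOrbit_of_gram`: the three Gram matrices of `⟨m⟩` are the identity and `⟨m⟩` is
concise in each leg), in place of the printed route through Prop. 4.8 with `R = 𝒯_m`.
[cite: BurgisserIkenmeyer2017, Cor. 4.9] -/
theorem BI2017_cor_4_9_unitTensor_holds : BI2017_cor_4_9_unitTensor := by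
  intro m
  refine isPolystableTensor_of_gram (unitTensor ℂ m) gram_unitTensor₁ gram_unitTensor₂
    gram_unitTensor₃ ?_ ?_ ?_
  · intro v hv
    funext a
    have h := hv a a
    rw [Finset.sum_eq_single a] at h
    · rwa [unitTensor_diag m, mul_one] at h
    · intro b _ hb; rw [unitTensor_eq_zero₁₂ hb, mul_zero]
    · simp
  · intro v hv
    funext b
    have h := hv b b
    rw [Finset.sum_eq_single b] at h
    · rwa [unitTensor_diag m, mul_one] at h
    · intro a _ ha; rw [unitTensor_eq_zero₁₂ (Ne.symm ha), mul_zero]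
    · simp
  · intro v hv
    funext c
    have h := hv c c
    rw [Finset.sum_eq_single c] at h
    · rwa [unitTensor_diag m, mul_one] at h
    · intro a _ ha; rw [unitTensor_eq_zero₂₃ c (Ne.symm ha), mul_zero]
    · simp

/-- **BI 2017, Cor. 4.9 — both clauses as one theorem**: `⟨m⟩` (above) and `⟨n,n,n⟩` (the tree's
discharged `BurgisserIkenmeyer2017_cor49_matMulTensor_holds`, Bläser coordinates) are polystable.
[cite: BurgisserIkenmeyer2017, Cor. 4.9] -/
theorem BI2017_cor_4_9 :
    (∀ m : ℕ, IsPolystableTensor (unitTensor ℂ m)) ∧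
      ∀ n : ℕ, IsPolystableTensor (matMulTensor ℂ n n n) :=
  ⟨BI2017_cor_4_9_unitTensor_holds,
    BurgisserIkenmeyer2017_cor49_matMulTensor_iff.mp BurgisserIkenmeyer2017_cor49_matMulTensor_holds⟩

/-- Entries of `(M₁ ⊗ M₂ ⊗ M₃)·⟨n,n,n⟩` in BI's coordinates:
`∑_{κ,μ,ν} M₁[a,(ν,κ)] M₂[b,(κ,μ)] M₃[c,(μ,ν)]` (the tree's `actTensor_matMulTensor_apply` in
Bläser coordinates, transported along the first-index swap `biMatMulTensor_apply_eq`).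
[cite: BurgisserIkenmeyer2017, Thm. 4.5 (proof set-up)] -/
theorem actTensor_biMatMulTensor_apply {n : ℕ}
    (M₁ M₂ M₃ : Matrix (Fin n × Fin n) (Fin n × Fin n) ℂ) (a b c : Fin n × Fin n) :
    actTensor M₁ M₂ M₃ (biMatMulTensor ℂ n) a b c =
      ∑ κ : Fin n, ∑ μ : Fin n, ∑ ν : Fin n, M₁ a (ν, κ) * M₂ b (κ, μ) * M₃ c (μ, ν) := by
  have hswap : actTensor M₁ M₂ M₃ (biMatMulTensor ℂ n) a b c =
      actTensor (Matrix.of fun x y : Fin n × Fin n => M₁ x y.swap) M₂ M₃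
        (matMulTensor ℂ n n n) a b c := by
    simp only [actTensor, Matrix.of_apply, biMatMulTensor_apply_eq]
    exact (Fintype.sum_equiv (Equiv.prodComm (Fin n) (Fin n)) _ _ fun y => by
      simp [Equiv.prodComm_apply, Prod.swap_swap]).symm
  rw [hswap, actTensor_matMulTensor_apply]
  simp only [Matrix.of_apply, Prod.swap_prod_mk]

/-- **BI 2017, Thm. 4.5 — the inclusion `⊇` PROVED** (de Groote's easy direction): for
`A, B, C ∈ GL_n` the triple `(A ⊗ (B⁻¹)ᵀ, B ⊗ (C⁻¹)ᵀ, C ⊗ (A⁻¹)ᵀ)` — i.e. `X ↦ AXB⁻¹`,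
`Y ↦ BYC⁻¹`, `Z ↦ CZA⁻¹` — fixes `⟨n,n,n⟩ = ∑ |(ij)(jk)(ki)⟩`: in coordinates the three index sums
factor as `(BB⁻¹)_{b₁a₂} (CC⁻¹)_{c₁b₂} (AA⁻¹)_{a₁c₂}`. (The reverse inclusion, de Groote 1978 via
Skolem–Noether, is the content of the fact `BI2017_thm_4_5`.) [cite: BurgisserIkenmeyer2017, Thm. 4.5] -/
theorem actTensor_deGroote_biMatMulTensor {n : ℕ} (A B C : GL (Fin n) ℂ) :
    actTensor
        (Matrix.kronecker (A : Matrix (Fin n) (Fin n) ℂ)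
          ((B⁻¹ : GL (Fin n) ℂ) : Matrix (Fin n) (Fin n) ℂ).transpose)
        (Matrix.kronecker (B : Matrix (Fin n) (Fin n) ℂ)
          ((C⁻¹ : GL (Fin n) ℂ) : Matrix (Fin n) (Fin n) ℂ).transpose)
        (Matrix.kronecker (C : Matrix (Fin n) (Fin n) ℂ)
          ((A⁻¹ : GL (Fin n) ℂ) : Matrix (Fin n) (Fin n) ℂ).transpose)
        (biMatMulTensor ℂ n) =
      biMatMulTensor ℂ n := by
  funext a b c
  rw [actTensor_biMatMulTensor_apply]
  have hsummand : ∀ κ μ ν : Fin n,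
      Matrix.kronecker (A : Matrix (Fin n) (Fin n) ℂ)
          ((B⁻¹ : GL (Fin n) ℂ) : Matrix (Fin n) (Fin n) ℂ).transpose a (ν, κ) *
        Matrix.kronecker (B : Matrix (Fin n) (Fin n) ℂ)
          ((C⁻¹ : GL (Fin n) ℂ) : Matrix (Fin n) (Fin n) ℂ).transpose b (κ, μ) *
        Matrix.kronecker (C : Matrix (Fin n) (Fin n) ℂ)
          ((A⁻¹ : GL (Fin n) ℂ) : Matrix (Fin n) (Fin n) ℂ).transpose c (μ, ν) =
      ((B : Matrix (Fin n) (Fin n) ℂ) b.1 κ * ((B⁻¹ : GL (Fin n) ℂ) : Matrix (Fin n) (Fin n) ℂ) κ a.2) *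
        ((((C : Matrix (Fin n) (Fin n) ℂ) c.1 μ *
            ((C⁻¹ : GL (Fin n) ℂ) : Matrix (Fin n) (Fin n) ℂ) μ b.2)) *
          ((A : Matrix (Fin n) (Fin n) ℂ) a.1 ν *
            ((A⁻¹ : GL (Fin n) ℂ) : Matrix (Fin n) (Fin n) ℂ) ν c.2)) := by
    intro κ μ ν
    obtain ⟨a₁, a₂⟩ := a
    obtain ⟨b₁, b₂⟩ := b
    obtain ⟨c₁, c₂⟩ := c
    simp only [Matrix.kronecker, Matrix.kroneckerMap_apply, Matrix.transpose_apply]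
    ring
  simp_rw [hsummand, ← Finset.mul_sum, ← Finset.sum_mul]
  rw [← Matrix.mul_apply, ← Matrix.mul_apply, ← Matrix.mul_apply, ← Units.val_mul,
    ← Units.val_mul, ← Units.val_mul, mul_inv_cancel, mul_inv_cancel, mul_inv_cancel, Units.val_one]
  obtain ⟨a₁, a₂⟩ := a
  obtain ⟨b₁, b₂⟩ := b
  obtain ⟨c₁, c₂⟩ := c
  simp only [biMatMulTensor, Matrix.one_apply, @eq_comm _ a₂ b₁, @eq_comm _ b₂ c₁, @eq_comm _ c₂ a₁]
  by_cases h₁ : b₁ = a₂ <;> by_cases h₂ : c₁ = b₂ <;> by_cases h₃ : a₁ = c₂ <;>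
    simp [h₁, h₂, h₃]

/-- **BI 2017, Thm. 4.5, the inclusion `⊇` in the form of the fact `BI2017_thm_4_5`**: every triple
of the printed form lies in `stab(⟨n,n,n⟩)`. [cite: BurgisserIkenmeyer2017, Thm. 4.5] -/
theorem BI2017_thm_4_5_supset (n : ℕ) :
    {g : GL (Fin n × Fin n) ℂ × GL (Fin n × Fin n) ℂ × GL (Fin n × Fin n) ℂ |
        ∃ A B C : GL (Fin n) ℂ,
          (g.1 : Matrix (Fin n × Fin n) (Fin n × Fin n) ℂ) =
            Matrix.kronecker (A : Matrix (Fin n) (Fin n) ℂ)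
              ((B⁻¹ : GL (Fin n) ℂ) : Matrix (Fin n) (Fin n) ℂ).transpose ∧
          (g.2.1 : Matrix (Fin n × Fin n) (Fin n × Fin n) ℂ) =
            Matrix.kronecker (B : Matrix (Fin n) (Fin n) ℂ)
              ((C⁻¹ : GL (Fin n) ℂ) : Matrix (Fin n) (Fin n) ℂ).transpose ∧
          (g.2.2 : Matrix (Fin n × Fin n) (Fin n × Fin n) ℂ) =
            Matrix.kronecker (C : Matrix (Fin n) (Fin n) ℂ)
              ((A⁻¹ : GL (Fin n) ℂ) : Matrix (Fin n) (Fin n) ℂ).transpose} ⊆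
      tensorStab (biMatMulTensor ℂ n) := by
  rintro g ⟨A, B, C, h₁, h₂, h₃⟩
  rw [mem_tensorStab_iff, h₁, h₂, h₃]
  exact actTensor_deGroote_biMatMulTensor A B C

/-- The tree's sandwich family (`MatMulLieIsotropy.lean`, de Groote 1978) lies in the stabilizer of
the tree's `matMulTensor ℂ n n n` (Bläser coordinates): dictionary with the printed triple after the
first-index swap `biMatMulTensor_apply_eq` is `(P, Q, R) = (B, (C⁻¹)ᵀ, (A⁻¹)ᵀ)`.
[cite: BurgisserIkenmeyer2017, Thm. 4.5] -/
theorem sandwich_mem_tensorStab_matMulTensor {n : ℕ} (P Q R : GL (Fin n) ℂ)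
    (g : GL (Fin n × Fin n) ℂ × GL (Fin n × Fin n) ℂ × GL (Fin n × Fin n) ℂ)
    (h₁ : (g.1 : Matrix (Fin n × Fin n) (Fin n × Fin n) ℂ) =
      Matrix.kronecker (P : Matrix (Fin n) (Fin n) ℂ)⁻¹ᵀ (R : Matrix (Fin n) (Fin n) ℂ)⁻¹ᵀ)
    (h₂ : (g.2.1 : Matrix (Fin n × Fin n) (Fin n × Fin n) ℂ) =
      Matrix.kronecker (P : Matrix (Fin n) (Fin n) ℂ) (Q : Matrix (Fin n) (Fin n) ℂ))
    (h₃ : (g.2.2 : Matrix (Fin n × Fin n) (Fin n × Fin n) ℂ) =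
      Matrix.kronecker (Q : Matrix (Fin n) (Fin n) ℂ)⁻¹ᵀ (R : Matrix (Fin n) (Fin n) ℂ)) :
    g ∈ tensorStab (matMulTensor ℂ n n n) := by
  rw [mem_tensorStab_iff, h₁, h₂, h₃]
  exact actTensor_sandwich_matMulTensor _ _ _ (Matrix.isUnits_det_units P)
    (Matrix.isUnits_det_units Q) (Matrix.isUnits_det_units R)

/-- **BI 2017, Problem 5.23 (the 3D analogue of the Alon–Tarsi question), as a neutral predicate**
(L2454, p0021:L117): "Let `n` be even. Is the number of even Latin cubes of size `n` different from
the number of odd Latin cubes of size `n`?" — `latinCubeCount n ≠ 0`. An OPEN QUESTION of the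
source: this predicate is NOT asserted anywhere and is not a Literature statement; its verified
instances `n = 2, 4` are the fact `BI2017_latinCube_2_4` ("We have verified this in the cases
`n = 2` and `n = 4`", L2451), and `BI2017_cor_5_25` (2) is stated through `latinCubeCount n ≠ 0`
directly. [cite: BurgisserIkenmeyer2017, Problem 5.23] -/
def latinCubeQuestion (n : ℕ) : Prop :=
  latinCubeCount n ≠ 0

/-- `BI2017_latinCube_2_4` answers Problem 5.23 affirmatively for `n = 2` and `n = 4` (the cases
verified by computer in the source). [cite: BurgisserIkenmeyer2017, §5.2 (before Problem 5.23)] -/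
theorem latinCubeQuestion_two_and_four (h : BI2017_latinCube_2_4) :
    latinCubeQuestion 2 ∧ latinCubeQuestion 4 :=
  h

end SecondTypingProofs

/-! ### Prop. 5.22 discharged (val-lit row BI2017-B, t06): `F_n(⟨n²⟩)` counts signed Latin cubes,
and vanishes for odd `n ≥ 3`

Follows the printed proof [tex L2438–2452]: at `w = ⟨n²⟩` the monomial `∏_p w_{α(p)β(p)γ(p)}` is
`1` iff `α = β = γ` and `0` otherwise, so (5.5) collapses to `∑_α sgn_x(α) sgn_y(α) sgn_z(α)`, and a
non-Latin `α` contributes `0`; for part (2) the involution `α ↦ τ ∘ α` (`τ` a transposition of two of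
the `n²` symbols) multiplies each of the `3n` slice signs by `−1`, i.e. the cube sign by
`(−1)^{3n} = −1` for odd `n`. -/

section Prop522Proof

open Finset

variable (n : ℕ)

/-- A labeling that is not a Latin cube has sign `0` (one of `sgn_x, sgn_y, sgn_z` vanishes).
[cite: BurgisserIkenmeyer2017, Prop. 5.22 (proof)] -/
theorem latinCubeSign_eq_zero_of_not_isLatinCube {n : ℕ}
    (α : Fin n × Fin n × Fin n → Fin (n * n)) (h : ¬ IsLatinCube n α) :
    latinCubeSign n α = 0 := by
  unfold latinCubeSign labelSignX labelSignY labelSignZ sliceSign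
  unfold IsLatinCube at h
  by_cases hx : ∀ ℓ, Function.Bijective (xSliceMap n α ℓ)
  · by_cases hy : ∀ ℓ, Function.Bijective (ySliceMap n α ℓ)
    · have hz : ¬ ∀ ℓ, Function.Bijective (zSliceMap n α ℓ) := fun hz => h ⟨hx, hy, hz⟩
      rw [if_neg hz, mul_zero]
    · rw [if_neg hy, mul_zero, zero_mul]
  · rw [if_neg hx, zero_mul, zero_mul]

/-- `#even − #odd` Latin cubes as the sum of `sgn_x sgn_y sgn_z` over ALL labelings
`[n]³ → [n²]`. [cite: BurgisserIkenmeyer2017, Prop. 5.22 (proof)] -/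
theorem latinCubeCount_eq_sum_univ :
    latinCubeCount n = ∑ α : Fin n × Fin n × Fin n → Fin (n * n), latinCubeSign n α := by
  classical
  unfold latinCubeCount
  refine Finset.sum_subset (Finset.filter_subset _ _) fun α _ hα => ?_
  refine latinCubeSign_eq_zero_of_not_isLatinCube α fun hL => hα ?_
  exact Finset.mem_filter.mpr ⟨Finset.mem_univ _, hL⟩

/-- **BI 2017, Prop. 5.22 (1) — PROVED**: "`F_n(⟨n²⟩)` equals the difference between the number of
even Latin cubes of size `n` and the number of odd Latin cubes of size `n`."
[cite: BurgisserIkenmeyer2017, Prop. 5.22 (1)] -/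
theorem aeval_fundInvariantTensor_unitTensor :
    aeval (tensorPt (unitTensor ℂ (n * n))) (fundInvariantTensor n ℂ) = (latinCubeCount n : ℂ) := by
  classical
  rw [latinCubeCount_eq_sum_univ, Int.cast_sum]
  simp only [fundInvariantTensor, map_sum, map_mul, map_prod, MvPolynomial.aeval_X, tensorPt,
    unitTensor_apply, map_intCast]
  refine Finset.sum_congr rfl fun α _ => ?_
  simp_rw [Fintype.prod_boole]
  have hcond : ∀ β γ : Fin n × Fin n × Fin n → Fin (n * n),
      (∀ p, α p = β p ∧ β p = γ p) ↔ (α = β ∧ β = γ) := by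
    intro β γ
    constructor
    · intro h
      exact ⟨funext fun p => (h p).1, funext fun p => (h p).2⟩
    · rintro ⟨rfl, rfl⟩ p
      exact ⟨rfl, rfl⟩
  simp_rw [hcond, mul_ite, mul_one, mul_zero]
  rw [Finset.sum_eq_single α]
  · rw [Finset.sum_eq_single α]
    · rw [if_pos ⟨rfl, rfl⟩]
      simp [latinCubeSign]
    · intro γ _ hγ
      exact if_neg fun h => hγ h.2.symm
    · simp
  · intro β _ hβ
    exact Finset.sum_eq_zero fun γ _ => if_neg fun h => hβ h.1.symm
  · simp

/-- Composing every slice with a permutation `τ` of the `n²` labels multiplies the slice sign by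
`sgn(τ)^n` (one factor per slice). [cite: BurgisserIkenmeyer2017, Prop. 5.22 (proof of (2))] -/
theorem sliceSign_perm_comp (τ : Equiv.Perm (Fin (n * n)))
    (s : Fin n → Fin (n * n) → Fin (n * n)) :
    sliceSign n (fun ℓ => τ ∘ s ℓ) = ((Equiv.Perm.sign τ : ℤˣ) : ℤ) ^ n * sliceSign n s := by
  unfold sliceSign
  by_cases h : ∀ ℓ, Function.Bijective (s ℓ)
  · have h' : ∀ ℓ, Function.Bijective (τ ∘ s ℓ) := fun ℓ => τ.bijective.comp (h ℓ)
    rw [if_pos h', if_pos h]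
    have hℓ : ∀ ℓ, ((Kumar2015.seqSign (τ ∘ s ℓ) : ℤˣ) : ℤ) =
        ((Equiv.Perm.sign τ : ℤˣ) : ℤ) * ((Kumar2015.seqSign (s ℓ) : ℤˣ) : ℤ) := by
      intro ℓ
      have e1 : s ℓ = ⇑(Equiv.ofBijective (s ℓ) (h ℓ)) := rfl
      have e2 : τ ∘ s ℓ = ⇑(τ * Equiv.ofBijective (s ℓ) (h ℓ)) := rfl
      rw [e2, Kumar2015.seqSign_coe_perm, map_mul, Units.val_mul]
      conv_rhs => rw [e1, Kumar2015.seqSign_coe_perm]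
    simp_rw [hℓ, Finset.prod_mul_distrib, Finset.prod_const, Finset.card_univ, Fintype.card_fin]
  · have h' : ¬ ∀ ℓ, Function.Bijective (τ ∘ s ℓ) :=
      fun h' => h fun ℓ => (τ.bijective.of_comp_iff' (s ℓ)).mp (h' ℓ)
    rw [if_neg h', if_neg h, mul_zero]

/-- For odd `n`, composing a labeling with a transposition of two labels negates
`sgn_x sgn_y sgn_z` (the involution of the printed proof of Prop. 5.22 (2)).
[cite: BurgisserIkenmeyer2017, Prop. 5.22 (proof of (2))] -/
theorem latinCubeSign_swap_comp {n : ℕ} (hn : Odd n) {a b : Fin (n * n)} (hab : a ≠ b)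
    (α : Fin n × Fin n × Fin n → Fin (n * n)) :
    latinCubeSign n (Equiv.swap a b ∘ α) = -latinCubeSign n α := by
  have hsgn : ((Equiv.Perm.sign (Equiv.swap a b) : ℤˣ) : ℤ) ^ n = -1 := by
    rw [Equiv.Perm.sign_swap hab, Units.val_neg, Units.val_one, hn.neg_one_pow]
  have hx : xSliceMap n (Equiv.swap a b ∘ α) = fun ℓ => Equiv.swap a b ∘ xSliceMap n α ℓ := rfl
  have hy : ySliceMap n (Equiv.swap a b ∘ α) = fun ℓ => Equiv.swap a b ∘ ySliceMap n α ℓ := rfl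
  have hz : zSliceMap n (Equiv.swap a b ∘ α) = fun ℓ => Equiv.swap a b ∘ zSliceMap n α ℓ := rfl
  unfold latinCubeSign labelSignX labelSignY labelSignZ
  rw [hx, hy, hz, sliceSign_perm_comp, sliceSign_perm_comp, sliceSign_perm_comp, hsgn]
  ring

/-- **BI 2017, Prop. 5.22 (2), combinatorial core — PROVED**: for odd `n > 1` the signed count of
Latin cubes of size `n` vanishes (the printed involution exchanging two of the `n² ≥ 2` symbols; for
`n = 1` the count is `1`, whence the hypothesis `1 < n` of `BI2017_prop_5_22`).
[cite: BurgisserIkenmeyer2017, Prop. 5.22 (2)] -/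
theorem latinCubeCount_eq_zero_of_odd {n : ℕ} (hn : Odd n) (h1 : 1 < n) :
    latinCubeCount n = 0 := by
  classical
  have h2 : 1 < n * n := lt_of_lt_of_le h1 (Nat.le_mul_self n)
  have h0 : 0 < n * n := lt_trans zero_lt_one h2
  set a : Fin (n * n) := ⟨0, h0⟩
  set b : Fin (n * n) := ⟨1, h2⟩
  have hab : a ≠ b := by simp [a, b, Fin.ext_iff]
  rw [latinCubeCount_eq_sum_univ]
  have hflip : ∑ α : Fin n × Fin n × Fin n → Fin (n * n), latinCubeSign n α =
      -∑ α : Fin n × Fin n × Fin n → Fin (n * n), latinCubeSign n α :=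
    calc ∑ α : Fin n × Fin n × Fin n → Fin (n * n), latinCubeSign n α
        = ∑ α : Fin n × Fin n × Fin n → Fin (n * n), latinCubeSign n (Equiv.swap a b ∘ α) :=
          (Fintype.sum_equiv (Equiv.arrowCongr (Equiv.refl _) (Equiv.swap a b)) _ _
            fun α => rfl).symm
      _ = ∑ α : Fin n × Fin n × Fin n → Fin (n * n), -latinCubeSign n α :=
          Finset.sum_congr rfl fun α _ => latinCubeSign_swap_comp hn hab α
      _ = -∑ α : Fin n × Fin n × Fin n → Fin (n * n), latinCubeSign n α :=
          Finset.sum_neg_distrib _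
  omega

/-- **BI 2017, Prop. 5.22 — DISCHARGED**: `theorem BI2017_prop_5_22_holds : BI2017_prop_5_22`
(part (1) `aeval_fundInvariantTensor_unitTensor`, part (2) `latinCubeCount_eq_zero_of_odd`).
[cite: BurgisserIkenmeyer2017, Prop. 5.22] -/
theorem BI2017_prop_5_22_holds : BI2017_prop_5_22 := by
  intro n
  refine ⟨aeval_fundInvariantTensor_unitTensor n, fun hn h1 => ?_⟩
  rw [aeval_fundInvariantTensor_unitTensor, latinCubeCount_eq_zero_of_odd hn h1, Int.cast_zero]

/-- **Cor. 5.25 (2) made unconditional in one direction by Prop. 5.22**: for odd `n > 1` the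
Latin-cube count is `0`, so Problem 5.23 (`latinCubeQuestion`) is a question about EVEN `n` only, as
printed. [cite: BurgisserIkenmeyer2017, Prop. 5.22 (2) and Problem 5.23] -/
theorem not_latinCubeQuestion_of_odd {n : ℕ} (hn : Odd n) (h1 : 1 < n) : ¬ latinCubeQuestion n :=
  fun h => h (latinCubeCount_eq_zero_of_odd hn h1)

end Prop522Proof

/-! ### Prop. 4.4 discharged (val-lit row BI2017-B, t06): a tensor stabilized by `H_m` is a
multiple of `⟨m⟩`

Follows the printed proof [tex L1715–1730] ("a torus computation"): the diagonal triples
`(diag(a), diag(b), diag(c))` with `a_i b_i c_i = 1` and the diagonal permutations `(P_π, P_π, P_π)`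
lie in `stab(⟨m⟩)`; invariance of `w` under the former kills every entry `w_{ijk}` off the diagonal
`i = j = k`, invariance under the latter makes the diagonal entries equal. (Entries of a diagonal
triple acting: the tree's `actTensor_diagonal_apply`, `QuantumFunctionalsFree.lean`.) -/

section Prop44Proof

open Finset

variable {ι : Type*} [Fintype ι] [DecidableEq ι] {m : ℕ}

/-- Entries of `(P_π ⊗ P_π ⊗ P_π)·w` for a permutation matrix `P_π`.
[cite: BurgisserIkenmeyer2017, Prop. 4.4 (proof)] -/
theorem actTensor_permMatrix_apply (π₁ π₂ π₃ : Equiv.Perm ι) (w : ι → ι → ι → ℂ) (i j k : ι) :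
    actTensor (π₁.permMatrix ℂ) (π₂.permMatrix ℂ) (π₃.permMatrix ℂ) w i j k =
      w (π₁ i) (π₂ j) (π₃ k) := by
  have hP : ∀ (π : Equiv.Perm ι) (x y : ι), (π.permMatrix ℂ) x y = if y = π x then 1 else 0 := by
    intro π x y
    simp [Equiv.Perm.permMatrix, PEquiv.toMatrix_apply, Equiv.toPEquiv_apply, eq_comm]
  have hP1 : ∀ (π : Equiv.Perm ι) (x : ι), (π.permMatrix ℂ) x (π x) = 1 := fun π x => by
    rw [hP, if_pos rfl]
  have hP0 : ∀ (π : Equiv.Perm ι) (x y : ι), y ≠ π x → (π.permMatrix ℂ) x y = 0 :=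
    fun π x y h => by rw [hP, if_neg h]
  simp only [actTensor]
  rw [Finset.sum_eq_single (π₁ i)]
  · rw [Finset.sum_eq_single (π₂ j)]
    · rw [Finset.sum_eq_single (π₃ k)]
      · rw [hP1, hP1, hP1, one_mul, one_mul, one_mul]
      · intro c' _ hc'; rw [hP0 π₃ k c' hc', mul_zero, zero_mul]
      · intro h; exact absurd (Finset.mem_univ _) h
    · intro b' _ hb'
      exact Finset.sum_eq_zero fun c' _ => by rw [hP0 π₂ j b' hb', mul_zero, zero_mul, zero_mul]
    · intro h; exact absurd (Finset.mem_univ _) h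
  · intro a' _ ha'
    exact Finset.sum_eq_zero fun b' _ => Finset.sum_eq_zero fun c' _ => by
      rw [hP0 π₁ i a' ha', zero_mul, zero_mul, zero_mul]
  · intro h; exact absurd (Finset.mem_univ _) h

/-- The torus `𝒯_m = {(diag(a), diag(b), diag(c)) | a_i b_i c_i = 1}` fixes `⟨m⟩` (part of Thm. 4.3,
the inclusion `𝒯_m ⊆ stab(⟨m⟩)`). [cite: BurgisserIkenmeyer2017, Thm. 4.3 / Prop. 4.4 (proof)] -/
theorem actTensor_diagonal_unitTensor (a b c : Fin m → ℂ) (h : ∀ i, a i * b i * c i = 1) :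
    actTensor (Matrix.diagonal a) (Matrix.diagonal b) (Matrix.diagonal c) (unitTensor ℂ m) =
      unitTensor ℂ m := by
  funext i j k
  rw [actTensor_diagonal_apply, unitTensor_apply]
  by_cases hij : i = j ∧ j = k
  · obtain ⟨rfl, rfl⟩ := hij
    rw [if_pos ⟨rfl, rfl⟩, h, one_mul]
  · rw [if_neg hij, mul_zero]

/-- The diagonally embedded symmetric group fixes `⟨m⟩` (part of Thm. 4.3, the inclusion
`S_m ⊆ stab(⟨m⟩)`). [cite: BurgisserIkenmeyer2017, Thm. 4.3 / Prop. 4.4 (proof)] -/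
theorem actTensor_permMatrix_unitTensor (π : Equiv.Perm (Fin m)) :
    actTensor (π.permMatrix ℂ) (π.permMatrix ℂ) (π.permMatrix ℂ) (unitTensor ℂ m) =
      unitTensor ℂ m := by
  funext i j k
  rw [actTensor_permMatrix_apply, unitTensor_apply, unitTensor_apply]
  simp only [π.injective.eq_iff]

/-- A diagonal matrix with nonzero entries, as an element of `GL`.
[cite: BurgisserIkenmeyer2017, Thm. 4.3 (the torus `𝒯_m`)] -/
def diagGL (a : ι → ℂ) (ha : ∀ i, a i ≠ 0) : GL ι ℂ :=
  Matrix.GeneralLinearGroup.mkOfDetNeZero (Matrix.diagonal a)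
    (by rw [Matrix.det_diagonal]; exact Finset.prod_ne_zero_iff.mpr fun i _ => ha i)

/-- A permutation matrix as an element of `GL`. [cite: BurgisserIkenmeyer2017, Thm. 4.3 (the diagonal `S_m`)] -/
def permGL (π : Equiv.Perm ι) : GL ι ℂ :=
  Matrix.GeneralLinearGroup.mkOfDetNeZero (π.permMatrix ℂ)
    (by
      rw [Matrix.det_permutation]
      rcases Int.units_eq_one_or (Equiv.Perm.sign π) with h | h <;> simp [h])

/-- **BI 2017, Prop. 4.4 — DISCHARGED**: "If the stabilizer of some tensor `w ∈ ℂ^m ⊗ ℂ^m ⊗ ℂ^m`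
contains the stabilizer `H_m` of the unit tensor `⟨m⟩`, then `w = c⟨m⟩` for some `c ∈ ℂ`."
[cite: BurgisserIkenmeyer2017, Prop. 4.4] -/
theorem BI2017_prop_4_4_holds : BI2017_prop_4_4 := by
  intro m w hsub
  -- invariance under a stabilizing triple, entrywise
  have hfix : ∀ g : GL (Fin m) ℂ × GL (Fin m) ℂ × GL (Fin m) ℂ,
      actTensor (g.1 : Matrix (Fin m) (Fin m) ℂ) (g.2.1 : Matrix (Fin m) (Fin m) ℂ)
        (g.2.2 : Matrix (Fin m) (Fin m) ℂ) (unitTensor ℂ m) = unitTensor ℂ m →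
      actTensor (g.1 : Matrix (Fin m) (Fin m) ℂ) (g.2.1 : Matrix (Fin m) (Fin m) ℂ)
        (g.2.2 : Matrix (Fin m) (Fin m) ℂ) w = w :=
    fun g hg => (mem_tensorStab_iff w g).mp (hsub ((mem_tensorStab_iff _ g).mpr hg))
  have h2 : (2 : ℂ) ≠ 0 := two_ne_zero
  have hupd : ∀ (i l : Fin m), Function.update (1 : Fin m → ℂ) i 2 l *
      Function.update (1 : Fin m → ℂ) i 2⁻¹ l * (1 : Fin m → ℂ) l = 1 := by
    intro i l
    by_cases hl : l = i
    · subst hl; simp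
    · simp [Function.update_of_ne hl]
  have hne2 : ∀ (i l : Fin m), Function.update (1 : Fin m → ℂ) i 2 l ≠ 0 := by
    intro i l; by_cases hl : l = i
    · subst hl; simp
    · simp [Function.update_of_ne hl]
  have hne2' : ∀ (i l : Fin m), Function.update (1 : Fin m → ℂ) i 2⁻¹ l ≠ 0 := by
    intro i l; by_cases hl : l = i
    · subst hl; simp
    · simp [Function.update_of_ne hl]
  have hne1 : ∀ l : Fin m, (1 : Fin m → ℂ) l ≠ 0 := fun l => one_ne_zero
  -- off-diagonal entries vanish, first/second index
  have hoff₁₂ : ∀ i j k : Fin m, i ≠ j → w i j k = 0 := by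
    intro i j k hij
    have hg := hfix (diagGL _ (hne2 i), diagGL _ (hne2' i), diagGL _ hne1)
      (actTensor_diagonal_unitTensor _ _ _ (hupd i))
    have := congrFun (congrFun (congrFun hg i) j) k
    rw [show ((diagGL _ (hne2 i) : GL (Fin m) ℂ) : Matrix (Fin m) (Fin m) ℂ) =
        Matrix.diagonal (Function.update (1 : Fin m → ℂ) i 2) from rfl,
      show ((diagGL _ (hne2' i) : GL (Fin m) ℂ) : Matrix (Fin m) (Fin m) ℂ) =
        Matrix.diagonal (Function.update (1 : Fin m → ℂ) i 2⁻¹) from rfl,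
      show ((diagGL _ hne1 : GL (Fin m) ℂ) : Matrix (Fin m) (Fin m) ℂ) =
        Matrix.diagonal (1 : Fin m → ℂ) from rfl, actTensor_diagonal_apply] at this
    rw [Function.update_self, Function.update_of_ne (Ne.symm hij), Pi.one_apply, Pi.one_apply,
      mul_one, mul_one] at this
    -- this : 2 * w i j k = w i j k
    have h' : (2 - 1) * w i j k = 0 := by rw [sub_mul, one_mul, this, sub_self]
    norm_num at h'
    exact h'
  -- off-diagonal entries vanish, second/third index
  have hoff₂₃ : ∀ i j k : Fin m, j ≠ k → w i j k = 0 := by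
    intro i j k hjk
    have hg := hfix (diagGL _ hne1, diagGL _ (hne2 j), diagGL _ (hne2' j))
      (actTensor_diagonal_unitTensor _ _ _ fun l => by
        rw [Pi.one_apply, one_mul]
        have := hupd j l; rwa [Pi.one_apply, mul_one] at this)
    have := congrFun (congrFun (congrFun hg i) j) k
    rw [show ((diagGL _ hne1 : GL (Fin m) ℂ) : Matrix (Fin m) (Fin m) ℂ) =
        Matrix.diagonal (1 : Fin m → ℂ) from rfl,
      show ((diagGL _ (hne2 j) : GL (Fin m) ℂ) : Matrix (Fin m) (Fin m) ℂ) =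
        Matrix.diagonal (Function.update (1 : Fin m → ℂ) j 2) from rfl,
      show ((diagGL _ (hne2' j) : GL (Fin m) ℂ) : Matrix (Fin m) (Fin m) ℂ) =
        Matrix.diagonal (Function.update (1 : Fin m → ℂ) j 2⁻¹) from rfl,
      actTensor_diagonal_apply] at this
    rw [Function.update_self, Function.update_of_ne (Ne.symm hjk), Pi.one_apply, Pi.one_apply,
      one_mul, mul_one] at this
    have h' : (2 - 1) * w i j k = 0 := by rw [sub_mul, one_mul, this, sub_self]
    norm_num at h'
    exact h'
  -- diagonal entries agree
  have hdiag : ∀ i j : Fin m, w j j j = w i i i := by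
    intro i j
    have hg := hfix (permGL (Equiv.swap i j), permGL (Equiv.swap i j), permGL (Equiv.swap i j))
      (actTensor_permMatrix_unitTensor _)
    have := congrFun (congrFun (congrFun hg i) i) i
    rw [show ((permGL (Equiv.swap i j) : GL (Fin m) ℂ) : Matrix (Fin m) (Fin m) ℂ) =
        (Equiv.swap i j).permMatrix ℂ from rfl, actTensor_permMatrix_apply,
      Equiv.swap_apply_left] at this
    exact this
  -- conclusion
  rcases Nat.eq_zero_or_pos m with hm | hm
  · subst hm
    exact ⟨0, funext fun i => Fin.elim0 i⟩
  · refine ⟨w ⟨0, hm⟩ ⟨0, hm⟩ ⟨0, hm⟩, funext fun i => funext fun j => funext fun k => ?_⟩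
    rw [Pi.smul_apply, Pi.smul_apply, Pi.smul_apply, smul_eq_mul, unitTensor_apply]
    by_cases hijk : i = j ∧ j = k
    · obtain ⟨rfl, rfl⟩ := hijk
      rw [if_pos ⟨rfl, rfl⟩, mul_one, hdiag ⟨0, hm⟩ i]
    · rw [if_neg hijk, mul_zero]
      by_cases hij : i = j
      · exact hoff₂₃ i j k fun hjk => hijk ⟨hij, hjk⟩
      · exact hoff₁₂ i j k hij

end Prop44Proof

/-! ### Prop. 4.7 discharged (val-lit row BI2017-B, t06): a tensor stabilized by `stab(⟨n,n,n⟩)`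
is a multiple of `⟨n,n,n⟩`

Same torus-and-permutation computation as for Prop. 4.4, inside de Groote's family: the diagonal
sandwiches `X ↦ diag(s) X diag(s)⁻¹`-type triples kill every entry of `w` off the support
`{((i,j),(j,k),(k,i))}` of `⟨n,n,n⟩ = ∑ |(ij)(jk)(ki)⟩`, and the permutation sandwiches
`(P_σ ⊗ P_τ, P_τ ⊗ P_ρ, P_ρ ⊗ P_σ)` act transitively on that support. [tex L1773–1790] -/

section Prop47Proof

open Finset

variable {ι : Type*} [Fintype ι] [DecidableEq ι]

/-- A diagonal triple whose weight is `1` on the support of a tensor fixes it.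
[cite: BurgisserIkenmeyer2017, Prop. 4.8 (2) / Prop. 4.7 (proof)] -/
theorem actTensor_diagonal_eq_self_of_support (u v z : ι → ℂ) (t : ι → ι → ι → ℂ)
    (h : ∀ a b c, t a b c ≠ 0 → u a * v b * z c = 1) :
    actTensor (Matrix.diagonal u) (Matrix.diagonal v) (Matrix.diagonal z) t = t := by
  funext a b c
  rw [actTensor_diagonal_apply]
  by_cases ht : t a b c = 0
  · rw [ht, mul_zero]
  · rw [h a b c ht, one_mul]

/-- The permutation sandwiches `(P_σ ⊗ P_τ, P_τ ⊗ P_ρ, P_ρ ⊗ P_σ)` fix `⟨n,n,n⟩ = ∑ |(ij)(jk)(ki)⟩`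
(they lie in de Groote's family, Thm. 4.5). [cite: BurgisserIkenmeyer2017, Thm. 4.5 / Prop. 4.7 (proof)] -/
theorem actTensor_prodCongr_biMatMulTensor {n : ℕ} (σ τ ρ : Equiv.Perm (Fin n)) :
    actTensor (Equiv.Perm.permMatrix ℂ (Equiv.prodCongr σ τ))
        (Equiv.Perm.permMatrix ℂ (Equiv.prodCongr τ ρ))
        (Equiv.Perm.permMatrix ℂ (Equiv.prodCongr ρ σ)) (biMatMulTensor ℂ n) =
      biMatMulTensor ℂ n := by
  funext a b c
  rw [actTensor_permMatrix_apply]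
  obtain ⟨a₁, a₂⟩ := a
  obtain ⟨b₁, b₂⟩ := b
  obtain ⟨c₁, c₂⟩ := c
  simp only [biMatMulTensor, Equiv.prodCongr_apply, Prod.map_apply, τ.injective.eq_iff,
    ρ.injective.eq_iff, σ.injective.eq_iff]

/-- **BI 2017, Prop. 4.7 — DISCHARGED**: "If the stabilizer of some tensor `w ∈ ⊗³ℂ^{n×n}` contains
the stabilizer of `⟨n,n,n⟩`, then `w = c⟨n,n,n⟩` for some `c ∈ ℂ`."
[cite: BurgisserIkenmeyer2017, Prop. 4.7] -/
theorem BI2017_prop_4_7_holds : BI2017_prop_4_7 := by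
  intro n w hsub
  have hfix : ∀ g : GL (Fin n × Fin n) ℂ × GL (Fin n × Fin n) ℂ × GL (Fin n × Fin n) ℂ,
      actTensor (g.1 : Matrix (Fin n × Fin n) (Fin n × Fin n) ℂ)
        (g.2.1 : Matrix (Fin n × Fin n) (Fin n × Fin n) ℂ)
        (g.2.2 : Matrix (Fin n × Fin n) (Fin n × Fin n) ℂ) (biMatMulTensor ℂ n) =
          biMatMulTensor ℂ n →
      actTensor (g.1 : Matrix (Fin n × Fin n) (Fin n × Fin n) ℂ)
        (g.2.1 : Matrix (Fin n × Fin n) (Fin n × Fin n) ℂ)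
        (g.2.2 : Matrix (Fin n × Fin n) (Fin n × Fin n) ℂ) w = w :=
    fun g hg => (mem_tensorStab_iff w g).mp (hsub ((mem_tensorStab_iff _ g).mpr hg))
  -- the scaling function `s = (1, …, 2, …, 1)` with the `2` at position `l₀`
  set s : Fin n → Fin n → ℂ := fun l₀ => Function.update (1 : Fin n → ℂ) l₀ 2 with hs
  have hs_self : ∀ l₀, s l₀ l₀ = 2 := fun l₀ => by simp [hs]
  have hs_ne : ∀ l₀ l, l ≠ l₀ → s l₀ l = 1 := fun l₀ l h => by simp [hs, Function.update_of_ne h]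
  have hs0 : ∀ l₀ l, s l₀ l ≠ 0 := by
    intro l₀ l
    by_cases h : l = l₀
    · subst h; rw [hs_self]; exact two_ne_zero
    · rw [hs_ne l₀ l h]; exact one_ne_zero
  have hs0' : ∀ l₀ l, (s l₀ l)⁻¹ ≠ 0 := fun l₀ l => inv_ne_zero (hs0 l₀ l)
  have hone : ∀ p : Fin n × Fin n, (1 : Fin n × Fin n → ℂ) p ≠ 0 := fun p => one_ne_zero
  -- from `2 * x = x` conclude `x = 0`
  have htwo : ∀ x : ℂ, 2 * x = x → x = 0 := by
    intro x hx
    have h' : (2 - 1) * x = 0 := by rw [sub_mul, one_mul, hx, sub_self]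
    norm_num at h'
    exact h'
  -- invariance under a diagonal triple, entrywise
  have hdiagfix : ∀ (u v z : Fin n × Fin n → ℂ) (hu : ∀ p, u p ≠ 0) (hv : ∀ p, v p ≠ 0)
      (hz : ∀ p, z p ≠ 0),
      (∀ a b c, biMatMulTensor ℂ n a b c ≠ 0 → u a * v b * z c = 1) →
      ∀ a b c, u a * v b * z c * w a b c = w a b c := by
    intro u v z hu hv hz hsupp a b c
    have hg := hfix (diagGL u hu, diagGL v hv, diagGL z hz)
      (actTensor_diagonal_eq_self_of_support u v z _ hsupp)
    have := congrFun (congrFun (congrFun hg a) b) c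
    rwa [show ((diagGL u hu : GL (Fin n × Fin n) ℂ) : Matrix _ _ ℂ) = Matrix.diagonal u from rfl,
      show ((diagGL v hv : GL (Fin n × Fin n) ℂ) : Matrix _ _ ℂ) = Matrix.diagonal v from rfl,
      show ((diagGL z hz : GL (Fin n × Fin n) ℂ) : Matrix _ _ ℂ) = Matrix.diagonal z from rfl,
      actTensor_diagonal_apply] at this
  have hsupp_iff : ∀ a b c : Fin n × Fin n, biMatMulTensor ℂ n a b c ≠ 0 ↔
      (a.2 = b.1 ∧ b.2 = c.1 ∧ c.2 = a.1) := by
    intro a b c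
    simp only [biMatMulTensor, ne_eq, ite_eq_right_iff, one_ne_zero, imp_false, not_not]
  -- (a) entries with `a.2 ≠ b.1` vanish
  have hoffA : ∀ a b c : Fin n × Fin n, a.2 ≠ b.1 → w a b c = 0 := by
    intro a b c hab
    refine htwo _ ?_
    have := hdiagfix (fun p => s a.2 p.2) (fun p => (s a.2 p.1)⁻¹) 1 (fun p => hs0 _ _)
      (fun p => hs0' _ _) hone (fun a' b' c' h => by
        obtain ⟨h1, -, -⟩ := (hsupp_iff a' b' c').mp h
        rw [Pi.one_apply, mul_one, h1, mul_inv_cancel₀ (hs0 _ _)]) a b c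
    simpa only [hs_self, hs_ne _ _ (Ne.symm hab), inv_one, mul_one, Pi.one_apply] using this
  -- (b) entries with `b.2 ≠ c.1` vanish
  have hoffB : ∀ a b c : Fin n × Fin n, b.2 ≠ c.1 → w a b c = 0 := by
    intro a b c hbc
    refine htwo _ ?_
    have := hdiagfix 1 (fun p => s b.2 p.2) (fun p => (s b.2 p.1)⁻¹) hone (fun p => hs0 _ _)
      (fun p => hs0' _ _) (fun a' b' c' h => by
        obtain ⟨-, h2, -⟩ := (hsupp_iff a' b' c').mp h
        rw [Pi.one_apply, one_mul, h2, mul_inv_cancel₀ (hs0 _ _)]) a b c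
    simpa only [hs_self, hs_ne _ _ (Ne.symm hbc), inv_one, mul_one, Pi.one_apply, one_mul] using this
  -- (c) entries with `c.2 ≠ a.1` vanish
  have hoffC : ∀ a b c : Fin n × Fin n, c.2 ≠ a.1 → w a b c = 0 := by
    intro a b c hca
    refine htwo _ ?_
    have := hdiagfix (fun p => (s c.2 p.1)⁻¹) 1 (fun p => s c.2 p.2) (fun p => hs0' _ _) hone
      (fun p => hs0 _ _) (fun a' b' c' h => by
        obtain ⟨-, -, h3⟩ := (hsupp_iff a' b' c').mp h
        rw [Pi.one_apply, mul_one, h3, inv_mul_cancel₀ (hs0 _ _)]) a b c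
    simpa only [hs_self, hs_ne _ _ (Ne.symm hca), inv_one, one_mul, Pi.one_apply, mul_one] using this
  -- (d) entries on the support agree
  have hdiag : ∀ i j k i' j' k' : Fin n,
      w (i', j') (j', k') (k', i') = w (i, j) (j, k) (k, i) := by
    intro i j k i' j' k'
    set π₁ : Equiv.Perm (Fin n × Fin n) := Equiv.prodCongr (Equiv.swap i i') (Equiv.swap j j')
    set π₂ : Equiv.Perm (Fin n × Fin n) := Equiv.prodCongr (Equiv.swap j j') (Equiv.swap k k')
    set π₃ : Equiv.Perm (Fin n × Fin n) := Equiv.prodCongr (Equiv.swap k k') (Equiv.swap i i')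
    have hg := hfix (permGL π₁, permGL π₂, permGL π₃) (actTensor_prodCongr_biMatMulTensor _ _ _)
    have := congrFun (congrFun (congrFun hg (i, j)) (j, k)) (k, i)
    rw [show ((permGL π₁ : GL (Fin n × Fin n) ℂ) : Matrix _ _ ℂ) = π₁.permMatrix ℂ from rfl,
      show ((permGL π₂ : GL (Fin n × Fin n) ℂ) : Matrix _ _ ℂ) = π₂.permMatrix ℂ from rfl,
      show ((permGL π₃ : GL (Fin n × Fin n) ℂ) : Matrix _ _ ℂ) = π₃.permMatrix ℂ from rfl,
      actTensor_permMatrix_apply] at this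
    simpa only [π₁, π₂, π₃, Equiv.prodCongr_apply, Prod.map_apply, Equiv.swap_apply_left]
      using this
  -- conclusion
  rcases Nat.eq_zero_or_pos n with hn | hn
  · subst hn
    exact ⟨0, funext fun a => Fin.elim0 a.1⟩
  · set o : Fin n := ⟨0, hn⟩
    refine ⟨w (o, o) (o, o) (o, o), funext fun a => funext fun b => funext fun c => ?_⟩
    rw [Pi.smul_apply, Pi.smul_apply, Pi.smul_apply, smul_eq_mul]
    obtain ⟨a₁, a₂⟩ := a
    obtain ⟨b₁, b₂⟩ := b
    obtain ⟨c₁, c₂⟩ := c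
    simp only [biMatMulTensor]
    by_cases h : a₂ = b₁ ∧ b₂ = c₁ ∧ c₂ = a₁
    · obtain ⟨h1, h2, h3⟩ := h
      rw [if_pos ⟨h1, h2, h3⟩, mul_one, ← h1, ← h2, h3]
      exact hdiag o o o a₁ a₂ b₂
    · rw [if_neg h, mul_zero]
      by_cases h1 : a₂ = b₁
      · by_cases h2 : b₂ = c₁
        · exact hoffC _ _ _ fun h3 => h ⟨h1, h2, h3⟩
        · exact hoffB _ _ _ h2
      · exact hoffA _ _ _ h1

end Prop47Proof

/-! ### Prop. 5.24, proved (t04) -/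

section PropositionFiveTwentyFourProof

variable {n : ℕ}

/-- A term `c · ∏_p w_{α(p)β(p)γ(p)}` of (5.5) evaluated at a tensor `t`. [cite: BurgisserIkenmeyer2017, §5.1 eq. (5.5)] -/
private theorem aeval_tensorPt_term {N : ℕ} {P : Type*} [Fintype P]
    (t : Fin N → Fin N → Fin N → ℂ) (c : ℂ) (α β γ : P → Fin N) :
    aeval (tensorPt t) (C c * ∏ p, X (α p, β p, γ p)) = c * ∏ p, t (α p) (β p) (γ p) := by
  rw [map_mul, MvPolynomial.aeval_C, map_prod]
  simp [MvPolynomial.aeval_X, tensorPt]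

/-- The monomial `∏_p w_{α(p)β(p)γ(p)}` at `w = ⟨n,n,n⟩ = ∑ |(ij)(jk)(ki)⟩` is `1` iff at every
point the three labels chain as `(ij), (jk), (ki)`, else `0` ("the structure of the matrix
multiplication tensor", L2468). [cite: BurgisserIkenmeyer2017, Prop. 5.24 (proof)] -/
private theorem prod_biMatMulTensorFin {P : Type*} [Fintype P] (α β γ : P → Fin (n * n)) :
    ∏ p, biMatMulTensorFin n ℂ (α p) (β p) (γ p) =
      if ∀ p, (finProdFinEquiv.symm (α p)).2 = (finProdFinEquiv.symm (β p)).1 ∧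
          (finProdFinEquiv.symm (β p)).2 = (finProdFinEquiv.symm (γ p)).1 ∧
          (finProdFinEquiv.symm (γ p)).2 = (finProdFinEquiv.symm (α p)).1 then 1 else 0 := by
  by_cases h : ∀ p, (finProdFinEquiv.symm (α p)).2 = (finProdFinEquiv.symm (β p)).1 ∧
      (finProdFinEquiv.symm (β p)).2 = (finProdFinEquiv.symm (γ p)).1 ∧
      (finProdFinEquiv.symm (γ p)).2 = (finProdFinEquiv.symm (α p)).1
  · rw [if_pos h]
    exact Finset.prod_eq_one fun p _ => by
      simp only [biMatMulTensorFin, biMatMulTensor, if_pos (h p)]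
  · rw [if_neg h]
    obtain ⟨p, hp⟩ := not_forall.mp h
    exact Finset.prod_eq_zero (Finset.mem_univ p) (by
      simp only [biMatMulTensorFin, biMatMulTensor, if_neg hp])

/-- "A labeling `α : [n]³ → [n]²` is given by its two coordinate maps `μ, ν : [n]³ → [n]`, i.e.,
`α(p) = (μ(p), ν(p))`" (L2464–2466): the bijection (pairs of coordinate maps) ≃ (labelings into
`[n²] = Fin (n*n)` via `finProdFinEquiv`). [cite: BurgisserIkenmeyer2017, §5.2 (before Prop. 5.24)] -/
private def pairLabelEquiv (n : ℕ) :
    ((Fin n × Fin n × Fin n → Fin n) × (Fin n × Fin n × Fin n → Fin n)) ≃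
      (Fin n × Fin n × Fin n → Fin (n * n)) where
  toFun q := fun p => finProdFinEquiv (q.1 p, q.2 p)
  invFun α := (fun p => (finProdFinEquiv.symm (α p)).1, fun p => (finProdFinEquiv.symm (α p)).2)
  left_inv q := by
    obtain ⟨μ, ν⟩ := q
    simp
  right_inv α := by
    funext p
    simp only [Prod.mk.eta, Equiv.apply_symm_apply]

/-- Summing over labelings `[n]³ → [n²]` = summing over pairs of coordinate maps.
[cite: BurgisserIkenmeyer2017, §5.2 (before Prop. 5.24)] -/
private theorem sum_labelings_eq {M : Type*} [AddCommMonoid M]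
    (F : (Fin n × Fin n × Fin n → Fin (n * n)) → M) :
    ∑ α, F α = ∑ μ : Fin n × Fin n × Fin n → Fin n, ∑ ν : Fin n × Fin n × Fin n → Fin n,
      F (fun p => finProdFinEquiv (μ p, ν p)) := by
  rw [← Fintype.sum_prod_type']
  exact (Fintype.sum_equiv (pairLabelEquiv n) _ _ fun _ => rfl).symm

/-- **BI 2017, Prop. 5.24, PROVED** ("obvious from (5.5) and the structure of the matrix
multiplication tensor", L2468): at `⟨n,n,n⟩` a term `(α, β, γ)` of (5.5) survives iff
`α = (μ,ν)`, `β = (ν,π)`, `γ = (π,μ)` pointwise. [cite: BurgisserIkenmeyer2017, Prop. 5.24] -/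
theorem BI2017_prop_5_24_holds : BI2017_prop_5_24 := by
  intro n
  classical
  unfold fundInvariantTensor
  simp only [map_sum, aeval_tensorPt_term, prod_biMatMulTensorFin, mul_ite, mul_one, mul_zero]
  refine (sum_labelings_eq _).trans
    (Finset.sum_congr rfl fun μ _ => Finset.sum_congr rfl fun ν _ => ?_)
  refine (sum_labelings_eq _).trans ?_
  rw [Finset.sum_eq_single_of_mem ν (Finset.mem_univ ν)]
  · refine Finset.sum_congr rfl fun π _ => ?_
    refine (sum_labelings_eq _).trans ?_
    rw [Finset.sum_eq_single_of_mem π (Finset.mem_univ π),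
      Finset.sum_eq_single_of_mem μ (Finset.mem_univ μ)]
    · rw [if_pos]
      intro p
      simp
    · intro μ' _ hμ'
      rw [if_neg]
      intro hall
      apply hμ'
      funext p
      have h3 := (hall p).2.2
      simp only [Equiv.symm_apply_apply] at h3
      exact h3
    · intro π' _ hπ'
      refine Finset.sum_eq_zero fun μ' _ => ?_
      rw [if_neg]
      intro hall
      apply hπ'
      funext p
      have h2 := (hall p).2.1
      simp only [Equiv.symm_apply_apply] at h2
      exact h2.symm
  · intro ν' _ hν'
    refine Finset.sum_eq_zero fun π _ => ?_
    refine (sum_labelings_eq _).trans ?_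
    refine Finset.sum_eq_zero fun π' _ => Finset.sum_eq_zero fun μ' _ => ?_
    rw [if_neg]
    intro hall
    apply hν'
    funext p
    have h1 := (hall p).1
    simp only [Equiv.symm_apply_apply] at h1
    exact h1.symm

end PropositionFiveTwentyFourProof


/-! ### Thm. 4.3, the stabilizer of the unit tensor, proved (t04) -/

section TheoremFourThreeProof

open _root_.Matrix

variable {m : ℕ}

/-- Entries of a restriction of `⟨m⟩`: `((A ⊗ B ⊗ C)·⟨m⟩)_{ijk} = ∑_s A_{is} B_{js} C_{ks}` (the
columns-triads expansion; cf. `actTensor_unitTensor_apply` of `MatMulOccurrenceObstructionsProofs`).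
[cite: BurgisserIkenmeyer2017, Thm. 4.3 (proof)] -/
private theorem actTensor_unitTensor_apply' (A B C : Matrix (Fin m) (Fin m) ℂ) (i j k : Fin m) :
    actTensor A B C (unitTensor ℂ m) i j k = ∑ s, A i s * B j s * C k s := by
  rw [actTensor_apply]
  refine Finset.sum_congr rfl fun s _ => ?_
  rw [Finset.sum_eq_single s]
  · rw [Finset.sum_eq_single s]
    · simp
    · intro c _ hc
      simp [Ne.symm hc]
    · simp
  · intro b _ hb
    refine Finset.sum_eq_zero fun c _ => ?_
    simp [Ne.symm hb]
  · simp

/-- `(X E_{kk} Y)_{st} = X_{sk} Y_{kt}`. [folklore] -/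
private theorem mul_single_mul_apply (X Y : Matrix (Fin m) (Fin m) ℂ) (k s t : Fin m) :
    (X * Matrix.of (fun c d : Fin m => if c = k ∧ d = k then (1 : ℂ) else 0) * Y) s t =
      X s k * Y k t := by
  rw [Matrix.mul_apply, Finset.sum_eq_single_of_mem k (Finset.mem_univ k)]
  · rw [Matrix.mul_apply, Finset.sum_eq_single_of_mem k (Finset.mem_univ k)]
    · simp
    · intro c _ hc
      simp [hc]
  · intro d _ hd
    rw [Matrix.mul_apply, Finset.sum_eq_zero, zero_mul]
    intro c _
    simp [hd]

/-- **The key identity behind Thm. 4.3**: if `(A ⊗ B ⊗ C)·⟨m⟩ = ⟨m⟩` then for every `k` the `k`-th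
`z`-slice reads `A · diag(C_{k,·}) · Bᵀ = E_{kk}`, so `diag(C_{k,·}) = A⁻¹ E_{kk} B⁻ᵀ` is the outer
product of the `k`-th columns of `A⁻¹` and `B⁻¹`: `δ_{st} C_{ks} = A⁻¹_{sk} B⁻¹_{tk}`.
[cite: BurgisserIkenmeyer2017, Thm. 4.3 (proof)] -/
private theorem thm43_slice (A B C : GL (Fin m) ℂ)
    (H : actTensor (A : Matrix (Fin m) (Fin m) ℂ) (B : Matrix (Fin m) (Fin m) ℂ)
      (C : Matrix (Fin m) (Fin m) ℂ) (unitTensor ℂ m) = unitTensor ℂ m) (k s t : Fin m) :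
    (if s = t then (C : Matrix (Fin m) (Fin m) ℂ) k s else 0) =
      ((A⁻¹ : GL (Fin m) ℂ) : Matrix (Fin m) (Fin m) ℂ) s k *
        ((B⁻¹ : GL (Fin m) ℂ) : Matrix (Fin m) (Fin m) ℂ) t k := by
  set a : Matrix (Fin m) (Fin m) ℂ := ((A : GL (Fin m) ℂ) : Matrix (Fin m) (Fin m) ℂ) with ha
  set b : Matrix (Fin m) (Fin m) ℂ := ((B : GL (Fin m) ℂ) : Matrix (Fin m) (Fin m) ℂ) with hb
  set c : Matrix (Fin m) (Fin m) ℂ := ((C : GL (Fin m) ℂ) : Matrix (Fin m) (Fin m) ℂ) with hc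
  set ai : Matrix (Fin m) (Fin m) ℂ := ((A⁻¹ : GL (Fin m) ℂ) : Matrix (Fin m) (Fin m) ℂ) with hai
  set bi : Matrix (Fin m) (Fin m) ℂ := ((B⁻¹ : GL (Fin m) ℂ) : Matrix (Fin m) (Fin m) ℂ) with hbi
  have hai_mul : ai * a = 1 := by rw [hai, ha, ← Units.val_mul, inv_mul_cancel, Units.val_one]
  have hb_mul : bi * b = 1 := by rw [hbi, hb, ← Units.val_mul, inv_mul_cancel, Units.val_one]
  -- the `k`-th slice: `a · diag(c_{k,·}) · bᵀ = E_{kk}`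
  have hslice : a * diagonal (fun s => c k s) * bᵀ =
      Matrix.of (fun i j : Fin m => if i = k ∧ j = k then (1 : ℂ) else 0) := by
    ext i j
    have h := congrFun (congrFun (congrFun H i) j) k
    rw [actTensor_unitTensor_apply', unitTensor_apply] at h
    rw [Matrix.mul_apply, Matrix.of_apply]
    simp only [mul_diagonal, Matrix.transpose_apply]
    have hcond : (i = j ∧ j = k) ↔ (i = k ∧ j = k) := by
      constructor
      · rintro ⟨rfl, rfl⟩; exact ⟨rfl, rfl⟩
      · rintro ⟨rfl, rfl⟩; exact ⟨rfl, rfl⟩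
    rw [← if_congr hcond rfl rfl, ← h]
    exact Finset.sum_congr rfl fun s _ => by ring
  -- invert: `diag(c_{k,·}) = a⁻¹ E_{kk} b⁻ᵀ`
  have hdiag : diagonal (fun s => c k s) =
      ai * Matrix.of (fun i j : Fin m => if i = k ∧ j = k then (1 : ℂ) else 0) * biᵀ := by
    rw [← hslice]
    calc diagonal (fun s => c k s)
        = (ai * a) * diagonal (fun s => c k s) * (bi * b)ᵀ := by
          rw [hai_mul, hb_mul, Matrix.one_mul, transpose_one, Matrix.mul_one]
      _ = ai * (a * diagonal (fun s => c k s) * bᵀ) * biᵀ := by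
          rw [transpose_mul]
          simp only [Matrix.mul_assoc]
  have h := congrFun (congrFun hdiag s) t
  rw [diagonal_apply, mul_single_mul_apply, Matrix.transpose_apply] at h
  exact h

/-- From the slice identity: each row of `C` has at most one nonzero entry.
[cite: BurgisserIkenmeyer2017, Thm. 4.3 (proof)] -/
private theorem thm43_row_unique (A B C : GL (Fin m) ℂ)
    (H : actTensor (A : Matrix (Fin m) (Fin m) ℂ) (B : Matrix (Fin m) (Fin m) ℂ)
      (C : Matrix (Fin m) (Fin m) ℂ) (unitTensor ℂ m) = unitTensor ℂ m) (k s t : Fin m)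
    (hs : (C : Matrix (Fin m) (Fin m) ℂ) k s ≠ 0) (ht : (C : Matrix (Fin m) (Fin m) ℂ) k t ≠ 0) :
    s = t := by
  by_contra hst
  have h1 := thm43_slice A B C H k s s
  have h2 := thm43_slice A B C H k t t
  have h3 := thm43_slice A B C H k s t
  rw [if_pos rfl] at h1 h2
  rw [if_neg hst] at h3
  have hA : ((A⁻¹ : GL (Fin m) ℂ) : Matrix (Fin m) (Fin m) ℂ) s k ≠ 0 := by
    intro h0; exact hs (by rw [h1, h0, zero_mul])
  have hB : ((B⁻¹ : GL (Fin m) ℂ) : Matrix (Fin m) (Fin m) ℂ) t k ≠ 0 := by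
    intro h0; exact ht (by rw [h2, h0, mul_zero])
  exact mul_ne_zero hA hB h3.symm

/-- **Monomial matrices.** An invertible matrix each of whose rows has at most one nonzero entry is
`diag(c) · P_σ` for a permutation `σ` (`P_σ x y = [y = σ x]`) and `c_k = C_{k,σ(k)} ≠ 0`. [folklore] -/
private theorem monomial_of_row_unique (C : GL (Fin m) ℂ)
    (hC : ∀ k s t : Fin m, (C : Matrix (Fin m) (Fin m) ℂ) k s ≠ 0 →
      (C : Matrix (Fin m) (Fin m) ℂ) k t ≠ 0 → s = t) :
    ∃ (σ : Equiv.Perm (Fin m)) (c : Fin m → ℂ), (∀ k, c k ≠ 0) ∧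
      (C : Matrix (Fin m) (Fin m) ℂ) = diagonal c * σ.permMatrix ℂ := by
  classical
  -- every row is nonzero
  have hrow : ∀ k, ∃ s, (C : Matrix (Fin m) (Fin m) ℂ) k s ≠ 0 := by
    intro k
    by_contra h
    exact (Matrix.GeneralLinearGroup.det_ne_zero C)
      (det_eq_zero_of_row_eq_zero k fun s => by_contra fun hs => h ⟨s, hs⟩)
  choose σf hσf using hrow
  -- `σf` is injective: otherwise some column of `C` vanishes
  have hinj : Function.Injective σf := by
    rw [Finite.injective_iff_surjective]
    by_contra hsurj
    obtain ⟨s₀, hs₀⟩ : ∃ s₀, ∀ k, σf k ≠ s₀ := by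
      simpa [Function.Surjective] using hsurj
    apply Matrix.GeneralLinearGroup.det_ne_zero C
    refine det_eq_zero_of_column_eq_zero s₀ fun k => ?_
    by_contra hk
    exact hs₀ k (hC k _ _ (hσf k) hk)
  let σ : Equiv.Perm (Fin m) := Equiv.ofBijective σf (Finite.injective_iff_bijective.mp hinj)
  refine ⟨σ, fun k => (C : Matrix (Fin m) (Fin m) ℂ) k (σf k), hσf, ?_⟩
  ext k s
  rw [diagonal_mul]
  have hP : (σ.permMatrix ℂ) k s = if s = σf k then (1 : ℂ) else 0 := by
    simp [σ, Equiv.Perm.permMatrix, PEquiv.toMatrix_apply, Equiv.toPEquiv_apply, eq_comm]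
  rw [hP]
  by_cases hks : s = σf k
  · subst hks
    rw [if_pos rfl, mul_one]
  · rw [if_neg hks, mul_zero]
    by_contra h
    exact hks (hC k _ _ h (hσf k))

/-- Entries of `diag(c) · P_σ`. [folklore] -/
private theorem diagonal_mul_permMatrix_apply (c : Fin m → ℂ) (σ : Equiv.Perm (Fin m))
    (k s : Fin m) : (diagonal c * σ.permMatrix ℂ) k s = if s = σ k then c k else 0 := by
  rw [diagonal_mul]
  have hP : (σ.permMatrix ℂ) k s = if s = σ k then (1 : ℂ) else 0 := by
    simp [Equiv.Perm.permMatrix, PEquiv.toMatrix_apply, Equiv.toPEquiv_apply, eq_comm]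
  rw [hP, mul_ite, mul_one, mul_zero]

/-- `det (diag(c) · P_σ) = sgn(σ) · ∏ c`. [folklore] -/
private theorem det_diagonal_mul_permMatrix (c : Fin m → ℂ) (σ : Equiv.Perm (Fin m)) :
    (diagonal c * σ.permMatrix ℂ).det = ((Equiv.Perm.sign σ : ℤ) : ℂ) * ∏ i, c i := by
  rw [det_mul, det_diagonal, det_permutation, mul_comm]

/-- The hypothesis `(A ⊗ B ⊗ C)·⟨m⟩ = ⟨m⟩` is invariant under the cyclic rotation of the three
factors (`⟨m⟩` is symmetric). [cite: BurgisserIkenmeyer2017, Thm. 4.3 (proof)] -/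
private theorem thm43_rotate (A B C : Matrix (Fin m) (Fin m) ℂ)
    (H : actTensor A B C (unitTensor ℂ m) = unitTensor ℂ m) :
    actTensor B C A (unitTensor ℂ m) = unitTensor ℂ m := by
  funext j k i
  have h := congrFun (congrFun (congrFun H i) j) k
  rw [actTensor_unitTensor_apply', unitTensor_apply] at h ⊢
  have hcond : (j = k ∧ k = i) ↔ (i = j ∧ j = k) := by
    constructor
    · rintro ⟨rfl, rfl⟩; exact ⟨rfl, rfl⟩
    · rintro ⟨rfl, rfl⟩; exact ⟨rfl, rfl⟩
  rw [if_congr hcond rfl rfl, ← h]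
  exact Finset.sum_congr rfl fun s _ => by ring

/-- **BI 2017, Thm. 4.3 — the inclusion `stab(⟨m⟩) ⊆ 𝒯_m ⋊ S_m`**: a stabilizing triple consists
of monomial matrices `(diag(a)P_π, diag(b)P_π, diag(c)P_π)` with one common permutation and
`a_i b_i c_i = 1`. [cite: BurgisserIkenmeyer2017, Thm. 4.3] -/
private theorem thm43_subset (g : GL (Fin m) ℂ × GL (Fin m) ℂ × GL (Fin m) ℂ)
    (hg : g ∈ tensorStab (unitTensor ℂ m)) :
    ∃ (π : Equiv.Perm (Fin m)) (a b c : Fin m → ℂ), (∀ i, a i * b i * c i = 1) ∧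
      (g.1 : Matrix (Fin m) (Fin m) ℂ) = diagonal a * π.permMatrix ℂ ∧
      (g.2.1 : Matrix (Fin m) (Fin m) ℂ) = diagonal b * π.permMatrix ℂ ∧
      (g.2.2 : Matrix (Fin m) (Fin m) ℂ) = diagonal c * π.permMatrix ℂ := by
  classical
  obtain ⟨A, B, C⟩ := g
  have H : actTensor (A : Matrix (Fin m) (Fin m) ℂ) (B : Matrix (Fin m) (Fin m) ℂ)
      (C : Matrix (Fin m) (Fin m) ℂ) (unitTensor ℂ m) = unitTensor ℂ m := hg
  have HB := thm43_rotate _ _ _ H          -- (B ⊗ C ⊗ A)·⟨m⟩ = ⟨m⟩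
  have HC := thm43_rotate _ _ _ HB         -- (C ⊗ A ⊗ B)·⟨m⟩ = ⟨m⟩
  obtain ⟨σC, c, hc0, hCeq⟩ := monomial_of_row_unique C (thm43_row_unique A B C H)
  obtain ⟨σA, a, ha0, hAeq⟩ := monomial_of_row_unique A (thm43_row_unique B C A HB)
  obtain ⟨σB, b, hb0, hBeq⟩ := monomial_of_row_unique B (thm43_row_unique C A B HC)
  -- the diagonal entries of `(A ⊗ B ⊗ C)·⟨m⟩` force a common permutation and `a_i b_i c_i = 1`
  have hdiag : ∀ i, σB i = σA i ∧ σC i = σA i ∧ a i * b i * c i = 1 := by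
    intro i
    have h := congrFun (congrFun (congrFun H i) i) i
    rw [actTensor_unitTensor_apply', unitTensor_apply, if_pos ⟨rfl, rfl⟩, hAeq, hBeq, hCeq,
      Finset.sum_eq_single_of_mem (σA i) (Finset.mem_univ _)] at h
    · simp only [diagonal_mul_permMatrix_apply] at h
      by_cases hB : σB i = σA i
      · by_cases hC : σC i = σA i
        · rw [if_pos hB.symm, if_pos hC.symm] at h
          exact ⟨hB, hC, h⟩
        · rw [if_neg (Ne.symm hC), mul_zero] at h
          exact absurd h zero_ne_one
      · rw [if_neg (Ne.symm hB), mul_zero, zero_mul] at h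
        exact absurd h zero_ne_one
    · intro s _ hs
      rw [diagonal_mul_permMatrix_apply, if_neg hs, zero_mul, zero_mul]
  have hσB : σB = σA := Equiv.ext fun i => (hdiag i).1
  have hσC : σC = σA := Equiv.ext fun i => (hdiag i).2.1
  refine ⟨σA, a, b, c, fun i => (hdiag i).2.2, hAeq, ?_, ?_⟩
  · rw [hBeq, hσB]
  · rw [hCeq, hσC]

/-- **BI 2017, Thm. 4.3, PROVED** (de Groote 1978; Bürgisser–Ikenmeyer 2011, Prop. 4.1): the
stabilizer of `⟨m⟩` is `𝒯_m ⋊ S_m` — every stabilizing triple is `(diag(a)P_π, diag(b)P_π, diag(c)P_π)`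
with `a_i b_i c_i = 1` (the `k`-th slice identity `A diag(C_{k,·}) Bᵀ = E_{kk}` makes every row of
`A, B, C` a single nonzero entry; the diagonal of `(A ⊗ B ⊗ C)⟨m⟩` forces one common permutation),
and conversely; the character `χ = det⊗det⊗det` takes the values `sgn(π)³ ∏ a_i b_i c_i = sgn π`, so
the stabilizer period is `|{±1}| = 2` for `m > 1` (L1667–1707). [cite: BurgisserIkenmeyer2017, Thm. 4.3] -/
theorem BI2017_thm_4_3_holds : BI2017_thm_4_3 := by
  intro m
  classical
  have hset : tensorStab (unitTensor ℂ m) =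
      {g | ∃ (π : Equiv.Perm (Fin m)) (a b c : Fin m → ℂ), (∀ i, a i * b i * c i = 1) ∧
        (g.1 : Matrix (Fin m) (Fin m) ℂ) = Matrix.diagonal a * π.permMatrix ℂ ∧
        (g.2.1 : Matrix (Fin m) (Fin m) ℂ) = Matrix.diagonal b * π.permMatrix ℂ ∧
        (g.2.2 : Matrix (Fin m) (Fin m) ℂ) = Matrix.diagonal c * π.permMatrix ℂ} := by
    ext g
    constructor
    · exact thm43_subset g
    · rintro ⟨π, a, b, c, habc, h1, h2, h3⟩
      rw [mem_tensorStab_iff, h1, h2, h3, ← actTensor_actTensor, actTensor_permMatrix_unitTensor,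
        actTensor_diagonal_unitTensor a b c habc]
  refine ⟨hset, fun hm => ?_⟩
  -- the period: `χ(stab ⟨m⟩) = {1, -1}`
  have hχ : ∀ g ∈ tensorStab (unitTensor ℂ m), tensorChi g = 1 ∨ tensorChi g = -1 := by
    intro g hg
    obtain ⟨π, a, b, c, habc, h1, h2, h3⟩ := thm43_subset g hg
    have hval : ((tensorChi g : ℂˣ) : ℂ) = ((Equiv.Perm.sign π : ℤ) : ℂ) := by
      rw [tensorChi, Units.val_mul, Units.val_mul, Matrix.GeneralLinearGroup.val_det_apply,
        Matrix.GeneralLinearGroup.val_det_apply, Matrix.GeneralLinearGroup.val_det_apply, h1, h2,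
        h3, det_diagonal_mul_permMatrix, det_diagonal_mul_permMatrix, det_diagonal_mul_permMatrix]
      have hprod : (∏ i, a i) * (∏ i, b i) * ∏ i, c i = 1 := by
        rw [← Finset.prod_mul_distrib, ← Finset.prod_mul_distrib]
        exact Finset.prod_eq_one fun i _ => habc i
      have hsq : ((Equiv.Perm.sign π : ℤ) : ℂ) * ((Equiv.Perm.sign π : ℤ) : ℂ) = 1 := by
        rw [← Int.cast_mul, ← Units.val_mul, Int.units_mul_self, Units.val_one, Int.cast_one]
      linear_combination ((Equiv.Perm.sign π : ℤ) : ℂ) * (∏ i, a i) * (∏ i, b i) * (∏ i, c i) * hsq +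
        ((Equiv.Perm.sign π : ℤ) : ℂ) * hprod
    rcases Int.units_eq_one_or (Equiv.Perm.sign π) with h | h
    · exact Or.inl (Units.ext (by rw [hval, h]; simp))
    · exact Or.inr (Units.ext (by rw [hval, h]; simp))
  -- `-1` is attained by the diagonal transposition `(P_τ, P_τ, P_τ)`, `τ = (0 1)`
  set i₀ : Fin m := ⟨0, by omega⟩ with hi₀
  set i₁ : Fin m := ⟨1, hm⟩ with hi₁
  have h01 : i₀ ≠ i₁ := by simp [hi₀, hi₁, Fin.ext_iff]
  set τ : Equiv.Perm (Fin m) := Equiv.swap i₀ i₁ with hτ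
  have hτmem : (permGL τ, permGL τ, permGL τ) ∈ tensorStab (unitTensor ℂ m) := by
    rw [mem_tensorStab_iff]
    exact actTensor_permMatrix_unitTensor τ
  have hτchi : tensorChi (permGL τ, permGL τ, permGL τ) = -1 := by
    apply Units.ext
    rw [tensorChi, Units.val_mul, Units.val_mul, Matrix.GeneralLinearGroup.val_det_apply]
    simp only [permGL, Matrix.GeneralLinearGroup.mkOfDetNeZero]
    rw [Matrix.GeneralLinearGroup.val_mk', det_permutation, hτ, Equiv.Perm.sign_swap h01]
    simp
  have himg : tensorStabChiImage (unitTensor ℂ m) = {1, -1} := by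
    ext u
    rw [tensorStabChiImage, Set.mem_image, Set.mem_insert_iff, Set.mem_singleton_iff]
    constructor
    · rintro ⟨g, hg, rfl⟩
      exact hχ g hg
    · rintro (rfl | rfl)
      · refine ⟨(1, 1, 1), ?_, ?_⟩
        · rw [mem_tensorStab_iff]
          simp only [Units.val_one]
          exact actTensor_one _
        · simp [tensorChi]
      · exact ⟨_, hτmem, hτchi⟩
  have hne : (1 : ℂˣ) ≠ -1 := by
    intro h
    have h' := congrArg (fun u : ℂˣ => (u : ℂ)) h
    norm_num at h'
  unfold tensorStabilizerPeriod
  rw [himg, Nat.card_coe_set_eq, Set.ncard_pair hne]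

end TheoremFourThreeProof


end Literature.Computability.AlgebraicComplexity

end
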